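import Literature.Geometry.Lorentzian.BoostedKerrCausalLegs
import Literature.Geometry.Lorentzian.KerrRadiusGradientVector
import Literature.Geometry.Lorentzian.CausalFutureProofs
import Literature.Geometry.Lorentzian.CausalityConditionsProofs
import HarnessLib

/-!
# The radius-uniform inward causal leg in a boosted Kerr–Schild chart (far zone)

Extension of `BoostedKerrCausalLegs` (same namespace `BoostedKerrLegs`): the **far ingoing leg**
`BoostedKerrLegs.FarIngoingLeg 𝒟`, PROVED for every vacuum Cauchy development `𝒟`
(`BoostedKerrLegs.farIngoingLeg_holds`).  In a boosted Kerr–Schild chart `Ψ` of a hole with `0 < M`,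
`|a| ≤ M`, for a shell radius `R₀ ≥ 100 M`: pointwise `C⁰`-closeness `‖(Ψ^*g − g_B)(x)‖ ≤ 1/(20‖Λ‖²)`
on the backward-free chart triangle `{t_y ≤ t, R₀ ≤ r, r + (t − t_y)/3 ≤ r_y}` above a chart point `y`
with `r_y ≥ R₀`, together with future-directedness of the push-forward `dΨ(ΛV)` of the background
time field `V = −g♯dt*` (`Kerr.timeVector`) at the later shell points `{t ≥ t_y, r = R₀}`, put a LATER
shell point `x`, `t_y ≤ t_x ≤ t_y + 3 (r_y − R₀)`, in the causal future of `Ψ y`.  Mechanism: the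
straight chart segment of rest-frame inward speed `½`, `θ ↦ y + θ Λ(1, −ξ/(2‖ξ‖))`, has chart time
`t₀ + θ` and radius `≤ r₀ − θ/3` (`radius_smul_le`), so it stays in the triangle; along it
`g(dΨu, dΨu) ≤ −1 + ¼ + 1/20 + 9/80 < 0` (`val_mfderiv_lorentz_le`), so `dΨu` is timelike; at the
shell end `dΨ(ΛV)` is future-directed and `g(dΨΛV, dΨu) < 0` (`val_mfderiv_timeVector_lt₄₀`:
`g_B(ΛV, ΛV) = −1 − 2H`, `g_B(ΛV, Λ(1, η)) = −1`, `‖V‖ ≤ 11/10`), hence `dΨu` is future-directed there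
and, by the one-sign lemma `isFutureDirected_mfderiv_apply_of_isPreconnected`, along the whole
segment; `leg_two_causal` concludes.  The constants do not decay in `r` (far-zone comparison with
Minkowski cones, Dafermos–Rodnianski arXiv:0811.0354, §5.1; causality bookkeeping O'Neill 1983,
Ch. 14, pp. 402–403).

Provenance: decomp-fsc lens-1 g40 side file `FarHandover40.lean` ll. 255–637 (the Δ-free piece FIL
and its `₄₀` coordinate helpers, re-derived from the private helpers of `BoostedKerrCausalLegs`),
re-homed verbatim up to docstrings / cite tags; the statement `FarIngoingLeg` is byte-identical to
the route-side text so the route's corollary is `exact BoostedKerrLegs.farIngoingLeg_holds 𝒟`.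

Second part (the LEG LADDER): the graded leg `BoostedKerrLegs.FarIngoingLegAt s k 𝒟` (slope `1/s`, waiting
time `s (r_y − R₀)`, closeness `1/(k‖Λ‖²)`; `FarIngoingLeg = FarIngoingLegAt 3 20` by `Iff.rfl`), monotone in
`(s, k)`, PROVED for every `s > (51/49)·(10001/10000)` with `k ≥ 200 s/(49 s − 51·(10001/10000))`
(`farIngoingLegAt_of_lt_three`, the `σ`-generic run of the same proof with the alignment-blind cone bounds
`kerrBilin_ofTimeSpace_one_le_of_norm_le_one`, `val_mfderiv_lorentz_le_of_norm_le_one`,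
`val_mfderiv_timeVector_lt_of_norm_le_one` and the roundness `norm_le_roundness_mul_radius`), the finite sub-grid
FIL_{3,7}, FIL_{2,9}, FIL_{3/2,14}, FIL_{11/10,76}, FIL_{21/20,473}, and the ALIGNED cone identity of the ingoing
chart at `a = 0`, `kerrBilin_radial_eq`: `g_{M,0}(v, v) = −(1 − σ)((1 + σ) − 2H(1 − σ))` for the inward radial
direction `v = (1, −σ x̂)` — timelike for every `σ < 1` wherever `2H < 1` (provenance: lens-1 g42/g43 side files
`ReachLadder42.lean` / `LegLadder43.lean`, the Δ-free §3σ block, verbatim up to names, docstrings, cite tags).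

NOT here: the two-chart ports (shell handover SH, wild layer W, the graded FH_θ / reach FIR_θ) and the profile
bookkeeping `CoherentProfile` / `coherentMinorant` — route side; the sliver `1 < s ≤ (51/49)·1.0001` (needs the
aligned sign of `ℓ(u)` for `a ≠ 0`) — not claimed.
-/

noncomputable section

open scoped Topology Manifold ContDiff ENNReal
open Filter Set Function

namespace Literature.Geometry.Lorentzian

namespace BoostedKerrLegs

-- typeclass search through nested operator types `E4 →L[ℝ] E4 →L[ℝ] ℝ` (as in `BoostedKerrCausalLegs`)
set_option maxSynthPendingDepth 3

variable {X : Type} [TopologicalSpace X] [ChartedSpace E3 X]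
  [IsManifold (𝓡 3) ((⊤ : ℕ∞) : WithTop ℕ∞) X] [ConnectedSpace X] {D : InitialDataSet (𝓡 3) X}
-- (`[T2Space X] [SecondCountableTopology X]` of the route-side variable block are not needed by any statement here)

/-- **The far ingoing leg `FarIngoingLeg 𝒟`** (Δ-free LEG · one chart · radius-UNIFORM · PROVED below,
`farIngoingLeg_holds`): in a boosted Kerr–Schild chart `Ψ` of a hole with `0 < M`, `|a| ≤ M`, into the vacuum
Cauchy development `𝒟`, and for a shell radius `R₀ ≥ 100 M`,
pointwise `C⁰`-closeness `‖(Ψ^*g − g_B)(x)‖ ≤ 1/(20‖Λ‖²)` on the backward-free chart triangle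
`{t_y ≤ t, R₀ ≤ r, r + (t − t_y)/3 ≤ r_y}` above a chart point `y` with `r_y ≥ R₀`, together with future-directedness
of the push-forward `dΨ(Λ V)` of the background's time field `V = −g♯dt*` (`Kerr.timeVector`) at the later shell points `{t ≥ t_y, r = R₀}`, put a LATER shell point `x`,
`t_y ≤ t_x ≤ t_y + 3 (r_y − R₀)`, in the causal future of `Ψ y` (the straight segment of rest-frame inward speed `½` is
`g`-timelike; its orientation is read off at the shell end against `dΨ(ΛV)` and transported back along the segment by
continuity).  The constants do not decay in `r`: this is what makes growing truncation radii harmless on the one-chart side.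
Far-zone comparison with Minkowski cones: Dafermos–Rodnianski arXiv:0811.0354, §5.1. [cite: arXiv08110354, §5.1] -/
def FarIngoingLeg (𝒟 : VacuumCauchyDevelopment D) : Prop :=
  ∀ (Λ : lorentzGroup) (c : E4) (M a : ℝ), 0 < M → |a| ≤ M → ∀ R₀ : ℝ, 100 * M ≤ R₀ →
    ∀ Ψ : (boostedKerrBackground Λ c M a).domain → 𝒟.carrier,
      ContMDiff 𝓘(ℝ, E4) (𝓡 4) ((⊤ : ℕ∞) : WithTop ℕ∞) Ψ →
      ∀ y : (boostedKerrBackground Λ c M a).domain, R₀ ≤ (boostedKerrBackground Λ c M a).radius y.1 →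
        (∀ x : (boostedKerrBackground Λ c M a).domain,
          (boostedKerrBackground Λ c M a).time y.1 ≤ (boostedKerrBackground Λ c M a).time x.1 →
          R₀ ≤ (boostedKerrBackground Λ c M a).radius x.1 →
          (boostedKerrBackground Λ c M a).radius x.1
              + ((boostedKerrBackground Λ c M a).time x.1 - (boostedKerrBackground Λ c M a).time y.1) / 3
            ≤ (boostedKerrBackground Λ c M a).radius y.1 →
          ‖𝒟.toSpacetime.deviation (boostedKerrBackground Λ c M a) Ψ x‖
            ≤ 1 / (20 * ‖((Λ : E4 ≃L[ℝ] E4) : E4 →L[ℝ] E4)‖ ^ 2)) →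
        (∀ x : (boostedKerrBackground Λ c M a).domain,
          (boostedKerrBackground Λ c M a).time y.1 ≤ (boostedKerrBackground Λ c M a).time x.1 →
          (boostedKerrBackground Λ c M a).radius x.1 = R₀ →
          𝒟.timeOrientation.IsFutureDirected
            (mfderiv 𝓘(ℝ, E4) (𝓡 4) Ψ x ((Λ : E4 ≃L[ℝ] E4) (Kerr.timeVector M a (poincareInv Λ c x.1))))) →
        ∃ x : (boostedKerrBackground Λ c M a).domain,
          (boostedKerrBackground Λ c M a).radius x.1 = R₀ ∧
          (boostedKerrBackground Λ c M a).time y.1 ≤ (boostedKerrBackground Λ c M a).time x.1 ∧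
          (boostedKerrBackground Λ c M a).time x.1
            ≤ (boostedKerrBackground Λ c M a).time y.1 + 3 * ((boostedKerrBackground Λ c M a).radius y.1 - R₀) ∧
          Ψ x ∈ 𝒟.metric.causalFuture 𝒟.timeOrientation {Ψ y}

/-! #### The proof of FIL (tree lemmas of `BoostedKerrCausalLegs` by name — its `private` coordinate helpers are re-derived here under `₄₀` names, private again) -/

/-- The affine rest-frame parametrisation of the inward leg: `(t₀ + θ, (1 + κθ) ξ) = (t₀, ξ) + θ (1, κ ξ)`. [folklore] -/
private theorem ofTimeSpace_affine₄₀ (t₀ κ θ : ℝ) (ξ : E3) :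
    E4.ofTimeSpace (t₀ + θ) ((1 + κ * θ) • ξ) = E4.ofTimeSpace t₀ ξ + θ • E4.ofTimeSpace 1 (κ • ξ) := by
  -- adapted from `ofTimeSpace_affine` (Literature/Geometry/Lorentzian/BoostedKerrCausalLegs, private)
  ext i
  refine Fin.cases ?_ (fun j ↦ ?_) i
  · simp
  · simp only [E4.ofTimeSpace_apply_succ, PiLp.add_apply, PiLp.smul_apply, smul_eq_mul]
    ring

/-- The rest frame of a lab point: `Λ⁻¹((Λ z + c) − c) = z`. [folklore] -/
private theorem poincareInv_apply_add₄₀ (Λ : lorentzGroup) (c z : E4) : poincareInv Λ c ((Λ : E4 ≃L[ℝ] E4) z + c) = z := by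
  -- adapted from `poincareInv_apply_add` (Literature/Geometry/Lorentzian/BoostedKerrCausalLegs, private)
  simp only [poincareInv, add_sub_cancel_right, ContinuousLinearEquiv.symm_apply_apply]

/-- `r₊ ≤ 2M`. [folklore] -/
private theorem rPlus_le_two_mul₄₀ {M : ℝ} (hM : 0 ≤ M) (a : ℝ) : Kerr.rPlus M a ≤ 2 * M := by
  -- adapted from `rPlus_le_two_mul` (Literature/Geometry/Lorentzian/BoostedKerrCausalLegs, private)
  unfold Kerr.rPlus
  have h : √(M ^ 2 - a ^ 2) ≤ M := (Real.sqrt_le_sqrt (by nlinarith [sq_nonneg a])).trans_eq (Real.sqrt_sq hM)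
  linarith

/-- Transfer of causality between the parametrisation `Ψ ∘ (chartAt E4 x₁).symm` at `w` and the chart map `Ψ` at `⟨w, hw⟩`. [folklore] -/
private theorem isCausal_comp_chartAt_symm_iff₄₀ (𝒟 : VacuumCauchyDevelopment D) (B : ModelBackground) (Ψ : B.domain → 𝒟.carrier)
    (x₁ : B.domain) {w : E4} (hw : w ∈ (B.domain : Set E4)) (hΨ : MDifferentiableAt 𝓘(ℝ, E4) (𝓡 4) Ψ ⟨w, hw⟩) (v : E4) :
    𝒟.metric.IsCausal (mfderiv 𝓘(ℝ, E4) (𝓡 4) (Ψ ∘ (chartAt E4 x₁).symm) w v) ↔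
      𝒟.metric.IsCausal (mfderiv 𝓘(ℝ, E4) (𝓡 4) Ψ ⟨w, hw⟩ v) := by
  -- adapted from `isCausal_comp_chartAt_symm_iff` (Literature/Geometry/Lorentzian/BoostedKerrCausalLegs, private)
  have hp : (chartAt E4 x₁).symm w = ⟨w, hw⟩ := Subtype.ext (OpensChart.chartAt_symm_val x₁ hw)
  rw [𝒟.toSpacetime.mfderiv_comp_chartAt_symm_apply B Ψ x₁ hw hΨ v]
  show 𝒟.metric.IsCausal (x := Ψ ((chartAt E4 x₁).symm w)) _ ↔ _
  rw [hp]

/-- Transfer of future-directedness between the parametrisation `Ψ ∘ (chartAt E4 x₁).symm` at `w` and the chart map `Ψ` at `⟨w, hw⟩`. [folklore] -/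
private theorem isFutureDirected_comp_chartAt_symm_iff₄₀ (𝒟 : VacuumCauchyDevelopment D) (B : ModelBackground)
    (Ψ : B.domain → 𝒟.carrier) (x₁ : B.domain) {w : E4} (hw : w ∈ (B.domain : Set E4))
    (hΨ : MDifferentiableAt 𝓘(ℝ, E4) (𝓡 4) Ψ ⟨w, hw⟩) (v : E4) :
    𝒟.timeOrientation.IsFutureDirected (mfderiv 𝓘(ℝ, E4) (𝓡 4) (Ψ ∘ (chartAt E4 x₁).symm) w v) ↔
      𝒟.timeOrientation.IsFutureDirected (mfderiv 𝓘(ℝ, E4) (𝓡 4) Ψ ⟨w, hw⟩ v) := by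
  -- adapted from `isFutureDirected_comp_chartAt_symm_iff` (Literature/Geometry/Lorentzian/BoostedKerrCausalLegs, private)
  have hp : (chartAt E4 x₁).symm w = ⟨w, hw⟩ := Subtype.ext (OpensChart.chartAt_symm_val x₁ hw)
  rw [𝒟.toSpacetime.mfderiv_comp_chartAt_symm_apply B Ψ x₁ hw hΨ v]
  show 𝒟.timeOrientation.IsFutureDirected (x := Ψ ((chartAt E4 x₁).symm w)) _ ↔ _
  rw [hp]

/-- `g(dΨv, dΨw) ≤ m + δ‖v‖‖w‖` from `g_B(v, w) ≤ m` and `‖(Ψ^*g − g_B)(x)‖ ≤ δ`. [folklore] -/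
private theorem val_mfderiv_le_of_norm_deviation_le₄₀ (𝒟 : VacuumCauchyDevelopment D) (B : ModelBackground) (Ψ : B.domain → 𝒟.carrier)
    (x : B.domain) {δ m : ℝ} (hdev : ‖𝒟.toSpacetime.deviation B Ψ x‖ ≤ δ) (v w : E4) (hm : B.bilin x.1 v w ≤ m) :
    𝒟.metric.val (Ψ x) (mfderiv 𝓘(ℝ, E4) (𝓡 4) Ψ x v) (mfderiv 𝓘(ℝ, E4) (𝓡 4) Ψ x w) ≤ m + δ * ‖v‖ * ‖w‖ := by
  -- adapted from `val_mfderiv_le_of_norm_deviation_le` (Literature/Geometry/Lorentzian/BoostedKerrCausalLegs, private)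
  have happ := 𝒟.toSpacetime.deviation_apply B Ψ x v w
  have h1 : 𝒟.toSpacetime.deviation B Ψ x v w ≤ ‖𝒟.toSpacetime.deviation B Ψ x‖ * ‖v‖ * ‖w‖ :=
    (Real.le_norm_self _).trans ((𝒟.toSpacetime.deviation B Ψ x).le_opNorm₂ v w)
  have h2 : ‖𝒟.toSpacetime.deviation B Ψ x‖ * ‖v‖ * ‖w‖ ≤ δ * ‖v‖ * ‖w‖ := by gcongr
  linarith

/-- The boosted background form in the rest frame: `g_B(x)(Λv, Λw) = g_{M,a}(Λ⁻¹(x − c))(v, w)`. [folklore] -/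
private theorem boosted_bilin_apply₄₀ (Λ : lorentzGroup) (c : E4) (M a : ℝ) (x v w : E4) :
    (boostedKerrBackground Λ c M a).bilin x ((Λ : E4 ≃L[ℝ] E4) v) ((Λ : E4 ≃L[ℝ] E4) w) = Kerr.bilin M a (poincareInv Λ c x) v w := by
  -- adapted from `boosted_bilin_apply` (Literature/Geometry/Lorentzian/BoostedKerrCausalLegs, private)
  show boostedKerrBilin Λ c M a x _ _ = _
  rw [boostedKerrBilin_apply, ContinuousLinearEquiv.symm_apply_apply, ContinuousLinearEquiv.symm_apply_apply]

/-- `‖V‖ ≤ 11/10` for the Kerr–Schild time field `V = e₀ − 2H ℓ♯` where `H ≤ 1/100` (`‖ℓ♯‖² = 2`). [folklore] -/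
private theorem norm_timeVector_le₄₀ {M a : ℝ} (hM : 0 ≤ M) {z : E4} (hz : 0 < Kerr.radius a z) (hH : Kerr.scalarH M a z ≤ 1 / 100) :
    ‖Kerr.timeVector M a z‖ ≤ 11 / 10 := by
  have hH0 := Kerr.scalarH_nonneg hM a z
  have hl : ‖Kerr.nullVector a z‖ ≤ 3 / 2 := by
    have hsq : ‖Kerr.nullVector a z‖ ^ 2 = 2 := by
      rw [EuclideanSpace.real_norm_sq_eq]
      simp only [Fin.sum_univ_four, Kerr.nullVector_apply_zero, Kerr.nullVector_apply_one, Kerr.nullVector_apply_two,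
        Kerr.nullVector_apply_three]
      have := Kerr.sum_sq_nullCovectorFun hz
      nlinarith
    nlinarith [norm_nonneg (Kerr.nullVector a z)]
  have h0 : ‖(E4.basisVector 0 : E4)‖ = 1 := by simp
  calc ‖Kerr.timeVector M a z‖ ≤ ‖(E4.basisVector 0 : E4)‖ + ‖(2 * Kerr.scalarH M a z) • Kerr.nullVector a z‖ := norm_sub_le _ _
    _ = 1 + 2 * Kerr.scalarH M a z * ‖Kerr.nullVector a z‖ := by
        rw [h0, norm_smul, Real.norm_eq_abs, abs_of_nonneg (by positivity)]
    _ ≤ 11 / 10 := by nlinarith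

/-- **Same-cone bound against S's time field.**  At a point of rest radius `≥ 100 M` where `‖Ψ^*g − g_B‖ ≤ 1/(20‖Λ‖²)`:
`g(dΨ ΛV, dΨ ΛV) < 0` and `g(dΨ ΛV, dΨ Λ(1, η)) < 0` for `‖η‖ ≤ ½` (`g_B(ΛV, ΛV) = −1 − 2H`, `g_B(ΛV, Λ(1,η)) = −1`,
`‖V‖ ≤ 11/10`).  O'Neill 1983, Ch. 5, Lemma 5.26; Dafermos–Rodnianski arXiv:0811.0354, §5.1. [folklore] -/
private theorem val_mfderiv_timeVector_lt₄₀ (𝒟 : VacuumCauchyDevelopment D) (Λ : lorentzGroup) (c : E4) {M : ℝ} (a : ℝ) (hM : 0 ≤ M)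
    (Ψ : (boostedKerrBackground Λ c M a).domain → 𝒟.carrier) (x : (boostedKerrBackground Λ c M a).domain)
    (hr : 100 * M ≤ (boostedKerrBackground Λ c M a).radius x.1)
    (hdev : ‖𝒟.toSpacetime.deviation (boostedKerrBackground Λ c M a) Ψ x‖ ≤ 1 / (20 * ‖((Λ : E4 ≃L[ℝ] E4) : E4 →L[ℝ] E4)‖ ^ 2))
    (η : E3) (hη : ‖η‖ ≤ 1 / 2) :
    𝒟.metric.val (Ψ x) (mfderiv 𝓘(ℝ, E4) (𝓡 4) Ψ x ((Λ : E4 ≃L[ℝ] E4) (Kerr.timeVector M a (poincareInv Λ c x.1))))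
        (mfderiv 𝓘(ℝ, E4) (𝓡 4) Ψ x ((Λ : E4 ≃L[ℝ] E4) (Kerr.timeVector M a (poincareInv Λ c x.1)))) < 0 ∧
      𝒟.metric.val (Ψ x) (mfderiv 𝓘(ℝ, E4) (𝓡 4) Ψ x ((Λ : E4 ≃L[ℝ] E4) (Kerr.timeVector M a (poincareInv Λ c x.1))))
        (mfderiv 𝓘(ℝ, E4) (𝓡 4) Ψ x ((Λ : E4 ≃L[ℝ] E4) (E4.ofTimeSpace 1 η))) < 0 := by
  set K := ‖((Λ : E4 ≃L[ℝ] E4) : E4 →L[ℝ] E4)‖ with hK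
  have hK1 : 1 ≤ K := BoostedKerrLegs.one_le_norm_lorentz Λ
  have hKpos : 0 < K := one_pos.trans_le hK1
  set z := poincareInv Λ c x.1 with hz
  have hz' : 0 < Kerr.radius a z := Kerr.radius_pos_of_mem_region x.2
  have hH : Kerr.scalarH M a z ≤ 1 / 100 := by
    have h1 := Kerr.scalarH_le_div hM a hz'
    have hr' : 100 * M ≤ Kerr.radius a z := hr
    calc Kerr.scalarH M a z ≤ M / Kerr.radius a z := h1
      _ ≤ 1 / 100 := by
          rw [div_le_div_iff₀ hz' (by norm_num : (0 : ℝ) < 100)]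
          linarith
  set V := Kerr.timeVector M a z with hV
  have hVn : ‖V‖ ≤ 11 / 10 := norm_timeVector_le₄₀ hM hz' hH
  have hΛV : ‖(Λ : E4 ≃L[ℝ] E4) V‖ ≤ K * (11 / 10) :=
    (((Λ : E4 ≃L[ℝ] E4) : E4 →L[ℝ] E4).le_opNorm V).trans (mul_le_mul_of_nonneg_left hVn (norm_nonneg _))
  have hΛη : ‖(Λ : E4 ≃L[ℝ] E4) (E4.ofTimeSpace 1 η)‖ ≤ K * (3 / 2) := by
    refine (((Λ : E4 ≃L[ℝ] E4) : E4 →L[ℝ] E4).le_opNorm _).trans (mul_le_mul_of_nonneg_left ?_ (norm_nonneg _))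
    have := BoostedKerrLegs.norm_ofTimeSpace_le 1 η
    rw [abs_one] at this
    linarith
  have hδ : 0 ≤ 1 / (20 * K ^ 2) := by positivity
  constructor
  · have hm : (boostedKerrBackground Λ c M a).bilin x.1 ((Λ : E4 ≃L[ℝ] E4) V) ((Λ : E4 ≃L[ℝ] E4) V) ≤ -1 := by
      rw [boosted_bilin_apply₄₀, ← hz, hV, Kerr.bilin_timeVector_timeVector hz']
      linarith [Kerr.scalarH_nonneg hM a z]
    have h := val_mfderiv_le_of_norm_deviation_le₄₀ 𝒟 _ Ψ x hdev _ _ hm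
    have hb : 1 / (20 * K ^ 2) * ‖(Λ : E4 ≃L[ℝ] E4) V‖ * ‖(Λ : E4 ≃L[ℝ] E4) V‖ ≤ 121 / 2000 := by
      have h1 : ‖(Λ : E4 ≃L[ℝ] E4) V‖ * ‖(Λ : E4 ≃L[ℝ] E4) V‖ ≤ (K * (11 / 10)) * (K * (11 / 10)) :=
        mul_le_mul hΛV hΛV (norm_nonneg _) (by positivity)
      calc 1 / (20 * K ^ 2) * ‖(Λ : E4 ≃L[ℝ] E4) V‖ * ‖(Λ : E4 ≃L[ℝ] E4) V‖
          ≤ 1 / (20 * K ^ 2) * ((K * (11 / 10)) * (K * (11 / 10))) := by rw [mul_assoc]; exact mul_le_mul_of_nonneg_left h1 hδ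
        _ = 121 / 2000 := by field_simp; ring
    linarith
  · have hm : (boostedKerrBackground Λ c M a).bilin x.1 ((Λ : E4 ≃L[ℝ] E4) V) ((Λ : E4 ≃L[ℝ] E4) (E4.ofTimeSpace 1 η)) ≤ -1 := by
      rw [boosted_bilin_apply₄₀, ← hz, hV, Kerr.bilin_timeVector hz', E4.ofTimeSpace_apply_zero]
    have h := val_mfderiv_le_of_norm_deviation_le₄₀ 𝒟 _ Ψ x hdev _ _ hm
    have hb : 1 / (20 * K ^ 2) * ‖(Λ : E4 ≃L[ℝ] E4) V‖ * ‖(Λ : E4 ≃L[ℝ] E4) (E4.ofTimeSpace 1 η)‖ ≤ 33 / 400 := by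
      have h1 : ‖(Λ : E4 ≃L[ℝ] E4) V‖ * ‖(Λ : E4 ≃L[ℝ] E4) (E4.ofTimeSpace 1 η)‖ ≤ (K * (11 / 10)) * (K * (3 / 2)) :=
        mul_le_mul hΛV hΛη (norm_nonneg _) (by positivity)
      calc 1 / (20 * K ^ 2) * ‖(Λ : E4 ≃L[ℝ] E4) V‖ * ‖(Λ : E4 ≃L[ℝ] E4) (E4.ofTimeSpace 1 η)‖
          ≤ 1 / (20 * K ^ 2) * ((K * (11 / 10)) * (K * (3 / 2))) := by rw [mul_assoc]; exact mul_le_mul_of_nonneg_left h1 hδ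
        _ = 33 / 400 := by field_simp; ring
    linarith
set_option maxHeartbeats 400000 in -- buildfix (bf3-g31): 160k/180k FAIL, 200k PASS at accept time; line-neutral budget line
/-- **The far ingoing leg holds** (PROVED): the radius-uniform inward causal leg.  Rest coordinates
`y = Λ(t₀, ξ) + c`, `r₀ = r(ξ) ≥ R₀`, `r₀ ≤ ‖ξ‖ ≤ 3r₀/2`; the chart segment `θ ↦ y + θ Λ(1, −ξ/(2‖ξ‖))` has chart
time `t₀ + θ` and radius `≤ (1 − θ/(2‖ξ‖)) r₀ ≤ r₀ − θ/3` (`radius_smul_le`), so it stays in the backward-free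
triangle; stop it at the FIRST parameter `θ⋆ ≤ 2‖ξ‖(1 − R₀/r₀) ≤ 3(r₀ − R₀)` with radius `R₀`.  Along it
`g(dΨu, dΨu) ≤ −1 + ¼ + 1/20 + 9/80 < 0` (`val_mfderiv_lorentz_le`), so `dΨu` is timelike; at the shell end
`dΨ(ΛV)` is future-directed (hypothesis) and timelike with `g(dΨΛV, dΨu) < 0` (`val_mfderiv_timeVector_lt₄₀`), hence
`dΨu` is future-directed THERE (`isFutureDirected_of_val_lt_zero`), hence at every point of the connected segment
(`isFutureDirected_mfderiv_apply_of_isPreconnected`), in particular at its start; `leg_two_causal` concludes.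
Dafermos–Rodnianski arXiv:0811.0354, §5.1 (far-zone cones); O'Neill 1983, Ch. 14, pp. 402–403. [cite: arXiv08110354, §5.1] -/
theorem farIngoingLeg_holds (𝒟 : VacuumCauchyDevelopment D) : FarIngoingLeg 𝒟 := by
  intro Λ c M a hM haM R₀ hR₀ Ψ hΨ y hy hdev hfd
  -- Step 1: rest-frame coordinates `(t₀, ξ)` of `y`, rest radius `r₀`
  set z : E4 := poincareInv Λ c y.1 with hz
  set t₀ : ℝ := z 0 with ht₀
  set ξ : E3 := E4.spatial z with hξ
  have hzts : E4.ofTimeSpace t₀ ξ = z := E4.ofTimeSpace_time_spatial z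
  have hylab : y.1 = (Λ : E4 ≃L[ℝ] E4) (E4.ofTimeSpace t₀ ξ) + c := by
    rw [hzts, hz, BoostedKerrLegs.apply_poincareInv_add]
  have hty : (boostedKerrBackground Λ c M a).time y.1 = t₀ := rfl
  set r₀ : ℝ := Kerr.radius a (E4.ofTimeSpace 0 ξ) with hr₀
  have hry : (boostedKerrBackground Λ c M a).radius y.1 = r₀ := by
    show Kerr.radius a (poincareInv Λ c y.1) = r₀
    rw [← hz, ← hzts, Kerr.radius_ofTimeSpace]
  have hR₀r₀ : R₀ ≤ r₀ := hry ▸ hy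
  have hM100 : 100 * M ≤ r₀ := hR₀.trans hR₀r₀
  have hR₀pos : 0 < R₀ := by linarith
  have hr₀pos : 0 < r₀ := by linarith
  -- the trivial case `r_y = R₀`
  rcases hR₀r₀.eq_or_lt with heq | hlt
  · refine ⟨y, by rw [hry, heq], le_rfl, by rw [hry, heq]; linarith, ?_⟩
    exact LorentzianMetric.mem_causalFuture_iff.2 (Or.inl rfl)
  -- Step 2: `r₀ ≤ ‖ξ‖ ≤ 3 r₀ / 2`
  have hξr₀ : r₀ ≤ ‖ξ‖ := Kerr.radius_ofTimeSpace_le_norm a 0 ξ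
  have hξpos : 0 < ‖ξ‖ := hr₀pos.trans_le hξr₀
  have hξup : ‖ξ‖ ≤ 3 / 2 * r₀ := by
    have h1 : ‖ξ‖ ^ 2 - a ^ 2 ≤ r₀ ^ 2 := by
      have h := Kerr.spatialNorm_sq_sub_sq_le_radius_sq a (E4.ofTimeSpace 0 ξ)
      rwa [E4.spatialNorm_ofTimeSpace] at h
    have h2 : a ^ 2 ≤ M ^ 2 := by
      have := abs_le.1 haM
      nlinarith
    nlinarith [norm_nonneg ξ]
  -- Step 3: the inward direction `u = Λ(1, κ ξ)`, `κ = −1/(2‖ξ‖)`, and the segment kinematics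
  set κ : ℝ := -(1 / (2 * ‖ξ‖)) with hκ
  have hκξ : ‖κ • ξ‖ = 1 / 2 := by
    rw [norm_smul, Real.norm_eq_abs, hκ, abs_neg, abs_of_pos (by positivity)]
    field_simp
  set u : E4 := (Λ : E4 ≃L[ℝ] E4) (E4.ofTimeSpace 1 (κ • ξ)) with hu
  have hrest : ∀ θ : ℝ, poincareInv Λ c (y.1 + θ • u) = E4.ofTimeSpace (t₀ + θ) ((1 + κ * θ) • ξ) := by
    intro θ
    have : y.1 + θ • u = (Λ : E4 ≃L[ℝ] E4) (E4.ofTimeSpace (t₀ + θ) ((1 + κ * θ) • ξ)) + c := by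
      rw [hylab, hu, ofTimeSpace_affine₄₀, map_add, map_smul]; abel
    rw [this, poincareInv_apply_add₄₀]
  have htime : ∀ θ : ℝ, (boostedKerrBackground Λ c M a).time (y.1 + θ • u) = t₀ + θ := fun θ ↦ by
    show poincareInv Λ c (y.1 + θ • u) 0 = _
    rw [hrest, E4.ofTimeSpace_apply_zero]
  have hradius : ∀ θ : ℝ, (boostedKerrBackground Λ c M a).radius (y.1 + θ • u) = Kerr.radius a (E4.ofTimeSpace 0 ((1 + κ * θ) • ξ)) := fun θ ↦ by
    show Kerr.radius a (poincareInv Λ c (y.1 + θ • u)) = _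
    rw [hrest, Kerr.radius_ofTimeSpace]
  -- radius decay along the segment: `r(θ) ≤ r₀ − θ/3` for `0 ≤ θ ≤ θ₁ := 2‖ξ‖(1 − R₀/r₀)`, and `r(θ₁) ≤ R₀`
  set θ₁ : ℝ := 2 * ‖ξ‖ * (1 - R₀ / r₀) with hθ₁
  have hθ₁nn : 0 ≤ θ₁ := by
    have : R₀ / r₀ ≤ 1 := (div_le_one hr₀pos).2 hR₀r₀
    have : 0 ≤ 1 - R₀ / r₀ := by linarith
    positivity
  have hθ₁le : θ₁ ≤ 3 * (r₀ - R₀) := by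
    have h1 : θ₁ = 2 * ‖ξ‖ * (r₀ - R₀) / r₀ := by rw [hθ₁]; field_simp
    rw [h1, div_le_iff₀ hr₀pos]
    nlinarith
  have hlam : ∀ θ ∈ Icc 0 θ₁, R₀ / r₀ ≤ 1 + κ * θ ∧ 1 + κ * θ ≤ 1 := by
    intro θ hθ
    have hκθ : κ * θ = -(θ / (2 * ‖ξ‖)) := by rw [hκ]; ring
    refine ⟨?_, by rw [hκθ]; linarith [div_nonneg hθ.1 (by positivity : (0 : ℝ) ≤ 2 * ‖ξ‖)]⟩
    have h1 : θ / (2 * ‖ξ‖) ≤ θ₁ / (2 * ‖ξ‖) := div_le_div_of_nonneg_right hθ.2 (by positivity)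
    have h2 : θ₁ / (2 * ‖ξ‖) = 1 - R₀ / r₀ := by rw [hθ₁]; field_simp
    rw [hκθ]; linarith
  have hdecay : ∀ θ ∈ Icc 0 θ₁, (boostedKerrBackground Λ c M a).radius (y.1 + θ • u) ≤ r₀ - θ / 3 := by
    intro θ hθ
    obtain ⟨hl, hu1⟩ := hlam θ hθ
    have hl0 : 0 < 1 + κ * θ := (div_pos hR₀pos hr₀pos).trans_le hl
    rw [hradius]
    refine (BoostedKerrLegs.radius_smul_le a ξ hl0 hu1 hr₀pos).trans ?_
    have hκθ : κ * θ = -(θ / (2 * ‖ξ‖)) := by rw [hκ]; ring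
    have h3 : θ / 3 ≤ θ / (2 * ‖ξ‖) * r₀ := by
      rw [div_mul_eq_mul_div, div_le_div_iff₀ (by norm_num : (0 : ℝ) < 3) (by positivity)]
      nlinarith [hθ.1]
    rw [hκθ]; nlinarith
  have hθ₁rad : (boostedKerrBackground Λ c M a).radius (y.1 + θ₁ • u) ≤ R₀ := by
    obtain ⟨hl, hu1⟩ := hlam θ₁ ⟨hθ₁nn, le_rfl⟩
    have hl0 : 0 < 1 + κ * θ₁ := (div_pos hR₀pos hr₀pos).trans_le hl
    rw [hradius]
    refine (BoostedKerrLegs.radius_smul_le a ξ hl0 hu1 hr₀pos).trans ?_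
    have : 1 + κ * θ₁ = R₀ / r₀ := by rw [hκ, hθ₁]; field_simp; ring
    rw [this, div_mul_cancel₀ R₀ hr₀pos.ne']
  -- Step 4: the FIRST parameter `θ⋆` at which the segment reaches the shell `r = R₀`
  set F : ℝ → ℝ := fun θ ↦ (boostedKerrBackground Λ c M a).radius (y.1 + θ • u) with hF
  have hFc : Continuous F :=
    (Kerr.continuous_radius a).comp ((continuous_poincareInv Λ c).comp (by fun_prop))
  set T : Set ℝ := Icc 0 θ₁ ∩ {θ | F θ ≤ R₀} with hT
  have hTc : IsClosed T := isClosed_Icc.inter (isClosed_le hFc continuous_const)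
  have hTne : T.Nonempty := ⟨θ₁, ⟨hθ₁nn, le_rfl⟩, hθ₁rad⟩
  have hTbdd : BddBelow T := ⟨0, fun θ hθ ↦ hθ.1.1⟩
  set θs : ℝ := sInf T with hθs
  have hθsT : θs ∈ T := hTc.csInf_mem hTne hTbdd
  have hθs0 : 0 ≤ θs := hθsT.1.1
  have hθs1 : θs ≤ θ₁ := hθsT.1.2
  have hFθs_le : F θs ≤ R₀ := hθsT.2
  have hF0 : F 0 = r₀ := by simp [hF, hry]
  have hbelow : ∀ θ, 0 ≤ θ → θ < θs → R₀ < F θ := by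
    intro θ h0 hlt'
    by_contra hle
    push Not at hle
    have : θs ≤ θ := csInf_le hTbdd ⟨⟨h0, hlt'.le.trans hθs1⟩, hle⟩
    linarith
  have hθspos : 0 < θs := by
    rcases hθs0.eq_or_lt with h | h
    · exfalso; rw [← h, hF0] at hFθs_le; linarith
    · exact h
  have hFθs : F θs = R₀ := by
    refine le_antisymm hFθs_le ?_
    by_contra hcon
    push Not at hcon
    obtain ⟨δ, hδ, hball⟩ := Metric.eventually_nhds_iff.1 (hFc.tendsto θs |>.eventually (gt_mem_nhds hcon))
    set θ' : ℝ := max 0 (θs - δ / 2) with hθ'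
    have hθ'lt : θ' < θs := max_lt hθspos (by linarith)
    have hθ'0 : 0 ≤ θ' := le_max_left _ _
    have hdist : dist θ' θs < δ := by
      rw [Real.dist_eq, abs_sub_comm, abs_of_pos (by linarith)]
      have : θs - δ / 2 ≤ θ' := le_max_right _ _
      linarith
    have h1 : F θ' < R₀ := hball hdist
    linarith [hbelow θ' hθ'0 hθ'lt]
  have hseg : ∀ θ ∈ Icc 0 θs, R₀ ≤ F θ ∧ F θ ≤ r₀ - θ / 3 := by
    intro θ hθ
    refine ⟨?_, hdecay θ ⟨hθ.1, hθ.2.trans hθs1⟩⟩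
    rcases hθ.2.eq_or_lt with h | h
    · rw [h, hFθs]
    · exact (hbelow θ hθ.1 h).le
  -- Step 5: the segment lies in the domain, inside the backward-free triangle; `C⁰` control and causality along it
  have hmem : ∀ θ ∈ Icc 0 θs, y.1 + θ • u ∈ ((boostedKerrBackground Λ c M a).domain : Set E4) := by
    intro θ hθ
    have hR : R₀ ≤ Kerr.radius a (poincareInv Λ c (y.1 + θ • u)) := (hseg θ hθ).1
    show poincareInv Λ c (y.1 + θ • u) ∈ Kerr.exterior M a
    rw [Kerr.mem_exterior]
    refine max_lt ?_ ?_
    · have : Kerr.rPlus M a ≤ 2 * M := rPlus_le_two_mul₄₀ hM.le a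
      linarith
    · linarith
  have hdevseg : ∀ θ ∈ Icc 0 θs, ∀ h : y.1 + θ • u ∈ ((boostedKerrBackground Λ c M a).domain : Set E4),
      ‖𝒟.toSpacetime.deviation (boostedKerrBackground Λ c M a) Ψ ⟨y.1 + θ • u, h⟩‖ ≤ 1 / (20 * ‖((Λ : E4 ≃L[ℝ] E4) : E4 →L[ℝ] E4)‖ ^ 2) := by
    intro θ hθ h
    obtain ⟨hlo, hhi⟩ := hseg θ hθ
    refine hdev ⟨y.1 + θ • u, h⟩ ?_ hlo ?_
    · show (boostedKerrBackground Λ c M a).time y.1 ≤ (boostedKerrBackground Λ c M a).time (y.1 + θ • u)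
      rw [htime, hty]; linarith [hθ.1]
    · show (boostedKerrBackground Λ c M a).radius (y.1 + θ • u) + ((boostedKerrBackground Λ c M a).time (y.1 + θ • u) - (boostedKerrBackground Λ c M a).time y.1) / 3 ≤ (boostedKerrBackground Λ c M a).radius y.1
      rw [htime, hty, hry]
      have : (boostedKerrBackground Λ c M a).radius (y.1 + θ • u) = F θ := rfl
      linarith
  have hrseg : ∀ θ ∈ Icc 0 θs, 100 * M ≤ (boostedKerrBackground Λ c M a).radius (y.1 + θ • u) := fun θ hθ ↦ hR₀.trans (hseg θ hθ).1
  have hcauseg : ∀ θ ∈ Icc 0 θs, ∀ h : y.1 + θ • u ∈ ((boostedKerrBackground Λ c M a).domain : Set E4),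
      𝒟.metric.IsCausal (mfderiv 𝓘(ℝ, E4) (𝓡 4) Ψ ⟨y.1 + θ • u, h⟩ u) := by
    intro θ hθ h
    have hv : 𝒟.metric.val (Ψ ⟨y.1 + θ • u, h⟩) (mfderiv 𝓘(ℝ, E4) (𝓡 4) Ψ ⟨y.1 + θ • u, h⟩ u)
        (mfderiv 𝓘(ℝ, E4) (𝓡 4) Ψ ⟨y.1 + θ • u, h⟩ u) ≤ -1 + 1 / 2 * (1 / 2) + 1 / 20 + (1 + 1 / 2) * (1 + 1 / 2) / 20 := by
      have := BoostedKerrLegs.val_mfderiv_lorentz_le 𝒟.toSpacetime Λ c a hM.le Ψ ⟨y.1 + θ • u, h⟩ (hrseg θ hθ)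
        (hdevseg θ hθ h) _ _ hκξ.le hκξ.le
      rwa [hκξ] at this
    exact (show 𝒟.metric.IsTimelike _ from lt_of_le_of_lt hv (by norm_num)).isCausal
  -- Step 6: the shell end point `e`; `dΨ(u)` is future-directed THERE (hypothesis on `dΨ(ΛV)` + same timecone)
  have hemem : y.1 + θs • u ∈ ((boostedKerrBackground Λ c M a).domain : Set E4) := hmem θs ⟨hθs0, le_rfl⟩
  set e : (boostedKerrBackground Λ c M a).domain := ⟨y.1 + θs • u, hemem⟩ with he
  have hte : (boostedKerrBackground Λ c M a).time e.1 = t₀ + θs := htime θs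
  have hre : (boostedKerrBackground Λ c M a).radius e.1 = R₀ := hFθs
  have hr₁ : 100 * M ≤ (boostedKerrBackground Λ c M a).radius e.1 := hrseg θs ⟨hθs0, le_rfl⟩
  have hdev₁ : ‖𝒟.toSpacetime.deviation (boostedKerrBackground Λ c M a) Ψ e‖ ≤ 1 / (20 * ‖((Λ : E4 ≃L[ℝ] E4) : E4 →L[ℝ] E4)‖ ^ 2) :=
    hdevseg θs ⟨hθs0, le_rfl⟩ hemem
  have hfd₀ : 𝒟.timeOrientation.IsFutureDirected
      (mfderiv 𝓘(ℝ, E4) (𝓡 4) Ψ e ((Λ : E4 ≃L[ℝ] E4) (Kerr.timeVector M a (poincareInv Λ c e.1)))) :=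
    hfd e (by rw [hte, hty]; linarith) hre
  obtain ⟨htl₀, hcross⟩ := val_mfderiv_timeVector_lt₄₀ 𝒟 Λ c a hM.le Ψ e hr₁ hdev₁ (κ • ξ) hκξ.le
  have hcau₀ : 𝒟.metric.IsCausal (mfderiv 𝓘(ℝ, E4) (𝓡 4) Ψ e u) := hcauseg θs ⟨hθs0, le_rfl⟩ hemem
  have hfd_e : 𝒟.timeOrientation.IsFutureDirected (mfderiv 𝓘(ℝ, E4) (𝓡 4) Ψ e u) :=
    𝒟.timeOrientation.isFutureDirected_of_val_lt_zero hfd₀ htl₀ hcau₀ hcross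
  -- Step 7: ONE SIGN along the connected segment — transport future-directedness from the end `e` back to the start `y`
  set ψ : E4 → 𝒟.carrier := Ψ ∘ (chartAt E4 y).symm with hψ
  have hψs : ContMDiffOn 𝓘(ℝ, E4) (𝓡 4) ((⊤ : ℕ∞) : WithTop ℕ∞) ψ ((boostedKerrBackground Λ c M a).domain : Set E4) :=
    𝒟.toSpacetime.contMDiffOn_comp_chartAt_symm (boostedKerrBackground Λ c M a) Ψ y hΨ
  have hmd : ∀ {w : E4} (hw : w ∈ ((boostedKerrBackground Λ c M a).domain : Set E4)), MDifferentiableAt 𝓘(ℝ, E4) (𝓡 4) Ψ ⟨w, hw⟩ :=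
    fun hw ↦ (hΨ ⟨_, hw⟩).mdifferentiableAt (by simp)
  set p : ℝ → E4 := fun θ ↦ y.1 + θ • u with hp
  have hpc : Continuous p := by fun_prop
  have hS : IsPreconnected (p '' Icc 0 θs) := isPreconnected_Icc.image p hpc.continuousOn
  have hSO : p '' Icc 0 θs ⊆ ((boostedKerrBackground Λ c M a).domain : Set E4) := by
    rintro _ ⟨θ, hθ, rfl⟩
    exact hmem θ hθ
  have hcS : ∀ w ∈ p '' Icc 0 θs, 𝒟.metric.IsCausal (mfderiv 𝓘(ℝ, E4) (𝓡 4) ψ w u) := by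
    rintro _ ⟨θ, hθ, rfl⟩
    exact (isCausal_comp_chartAt_symm_iff₄₀ 𝒟 (boostedKerrBackground Λ c M a) Ψ y (hmem θ hθ) (hmd (hmem θ hθ)) u).2 (hcauseg θ hθ (hmem θ hθ))
  have heS : y.1 + θs • u ∈ p '' Icc 0 θs := ⟨θs, ⟨hθs0, le_rfl⟩, rfl⟩
  have h₁ : 𝒟.timeOrientation.IsFutureDirected (mfderiv 𝓘(ℝ, E4) (𝓡 4) ψ (y.1 + θs • u) u) :=
    (isFutureDirected_comp_chartAt_symm_iff₄₀ 𝒟 (boostedKerrBackground Λ c M a) Ψ y hemem (hmd hemem) u).2 hfd_e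
  have hall := 𝒟.toSpacetime.isFutureDirected_mfderiv_apply_of_isPreconnected (boostedKerrBackground Λ c M a).domain.isOpen hψs hS hSO (fun _ ↦ u)
    continuousOn_const hcS heS h₁
  have hy0 : y.1 ∈ p '' Icc 0 θs := ⟨0, ⟨le_rfl, hθs0⟩, by simp [hp]⟩
  have h0 : 𝒟.timeOrientation.IsFutureDirected (mfderiv 𝓘(ℝ, E4) (𝓡 4) Ψ ⟨y.1, y.2⟩ u) :=
    (isFutureDirected_comp_chartAt_symm_iff₄₀ 𝒟 (boostedKerrBackground Λ c M a) Ψ y y.2 (hmd y.2) u).1 (hall y.1 hy0)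
  -- Step 8: leg 2 — the lifted segment is a future causal curve from `Ψ y` to `Ψ e`
  have hJ := BoostedKerrLegs.leg_two_causal 𝒟.toSpacetime (boostedKerrBackground Λ c M a) Ψ (boostedKerrBackground Λ c M a).domain.isOpen (fun _ h ↦ h) hΨ.contMDiffOn y.1 u hθspos
    hmem hcauseg y.2 hemem h0
  refine ⟨e, hre, by rw [hte, hty]; linarith, ?_, hJ⟩
  rw [hte, hty, hry]
  linarith

/-! ## The leg ladder `FarIngoingLegAt s k` (graded far ingoing leg) and its payment below slowness `3`

The text of `FarIngoingLeg` with the triangle slope `1/3 ↦ 1/s`, the waiting time `3 (r_y − R₀) ↦ s (r_y − R₀)`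
and the closeness constant `1/20 ↦ 1/k`; `FarIngoingLeg = FarIngoingLegAt 3 20` definitionally; monotone in
`(s, k)`; PROVED for every slowness `s > (51/49)·(10001/10000)` with `k ≥ 200 s/(49 s − 51·(10001/10000))` by the
`σ`-generic run of the proof of `farIngoingLeg_holds` (alignment-blind cone bounds
`kerrBilin_ofTimeSpace_one_le_of_norm_le_one`, `val_mfderiv_lorentz_le_of_norm_le_one`,
`val_mfderiv_timeVector_lt_of_norm_le_one`, roundness `norm_le_roundness_mul_radius`), together with the ALIGNED
cone identity at `a = 0` (`kerrBilin_radial_eq`: the inward radial direction of rest speed `σ` has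
`g_{M,0}(v,v) = −(1 − σ)((1 + σ) − 2H(1 − σ))`, timelike for every `σ < 1` wherever `2H < 1`).
Provenance: decomp-fsc lens-1 g42/g43 side files `ReachLadder42.lean` / `LegLadder43.lean` (the Δ-free
§3σ block), re-homed verbatim up to names (`₄₃` suffixes dropped), docstrings and cite tags. -/

/-- **The graded far ingoing leg `FarIngoingLegAt s k 𝒟`** (FIL_{s,k}, Δ-free, one chart, radius-uniform): the text of
`FarIngoingLeg` VERBATIM with the triangle slope `1/3 ↦ 1/s` (rest-frame inward chart speed `1/s`), the waiting time
`3 (r_y − R₀) ↦ s (r_y − R₀)` and the closeness constant `1/20 ↦ 1/k`; `FarIngoingLeg 𝒟 ↔ FarIngoingLegAt 3 20 𝒟` by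
`Iff.rfl` (`farIngoingLeg_iff_legAt`), monotone in `(s, k)` (`farIngoingLegAt_mono`), and PROVED below for every
`s > (51/49)·(10001/10000)` with `k ≥ 200 s/(49 s − 51·(10001/10000))` (`farIngoingLegAt_of_lt_three`).  In the ingoing
Kerr–Schild chart (`g_B = η + 2H ℓ ⊗ ℓ`, `ℓ₀ = 1`) the straight inward segment of rest speed `σ = 1/s < 1` is
`g_B`-timelike at `r ≥ 100 M` once the alignment-blind bound `|ℓ⃗·η| ≤ ‖η‖` is used
(`kerrBilin_ofTimeSpace_one_le_of_norm_le_one`); for `a = 0` the aligned identity `kerrBilin_radial_eq` gives the margin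
`(1 − σ)((1 + σ) − 2H(1 − σ))` down to `2H < 1`; `s ≤ 1` (chart speed `≥ 1`) is outside the method.  Far-zone cones of
Kerr: Dafermos–Rodnianski arXiv:0811.0354, §5.1. [cite: arXiv08110354, §5.1] -/
def FarIngoingLegAt (s k : ℝ) (𝒟 : VacuumCauchyDevelopment D) : Prop :=
  ∀ (Λ : lorentzGroup) (c : E4) (M a : ℝ), 0 < M → |a| ≤ M → ∀ R₀ : ℝ, 100 * M ≤ R₀ →
    ∀ Ψ : (boostedKerrBackground Λ c M a).domain → 𝒟.carrier,
      ContMDiff 𝓘(ℝ, E4) (𝓡 4) ((⊤ : ℕ∞) : WithTop ℕ∞) Ψ →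
      ∀ y : (boostedKerrBackground Λ c M a).domain, R₀ ≤ (boostedKerrBackground Λ c M a).radius y.1 →
        (∀ x : (boostedKerrBackground Λ c M a).domain,
          (boostedKerrBackground Λ c M a).time y.1 ≤ (boostedKerrBackground Λ c M a).time x.1 →
          R₀ ≤ (boostedKerrBackground Λ c M a).radius x.1 →
          (boostedKerrBackground Λ c M a).radius x.1
              + ((boostedKerrBackground Λ c M a).time x.1 - (boostedKerrBackground Λ c M a).time y.1) / s
            ≤ (boostedKerrBackground Λ c M a).radius y.1 →
          ‖𝒟.toSpacetime.deviation (boostedKerrBackground Λ c M a) Ψ x‖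
            ≤ 1 / (k * ‖((Λ : E4 ≃L[ℝ] E4) : E4 →L[ℝ] E4)‖ ^ 2)) →
        (∀ x : (boostedKerrBackground Λ c M a).domain,
          (boostedKerrBackground Λ c M a).time y.1 ≤ (boostedKerrBackground Λ c M a).time x.1 →
          (boostedKerrBackground Λ c M a).radius x.1 = R₀ →
          𝒟.timeOrientation.IsFutureDirected
            (mfderiv 𝓘(ℝ, E4) (𝓡 4) Ψ x ((Λ : E4 ≃L[ℝ] E4) (Kerr.timeVector M a (poincareInv Λ c x.1))))) →
        ∃ x : (boostedKerrBackground Λ c M a).domain,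
          (boostedKerrBackground Λ c M a).radius x.1 = R₀ ∧
          (boostedKerrBackground Λ c M a).time y.1 ≤ (boostedKerrBackground Λ c M a).time x.1 ∧
          (boostedKerrBackground Λ c M a).time x.1
            ≤ (boostedKerrBackground Λ c M a).time y.1 + s * ((boostedKerrBackground Λ c M a).radius y.1 - R₀) ∧
          Ψ x ∈ 𝒟.metric.causalFuture 𝒟.timeOrientation {Ψ y}

/-- `FarIngoingLeg` is the grade `(s, k) = (3, 20)` of the leg ladder — definitionally. [cite: arXiv08110354, §5.1] -/
theorem farIngoingLeg_iff_legAt (𝒟 : VacuumCauchyDevelopment D) : FarIngoingLeg 𝒟 ↔ FarIngoingLegAt 3 20 𝒟 := Iff.rfl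

/-- **The leg ladder is monotone**: a leg at slowness `s > 0` with closeness constant `1/(k‖Λ‖²)`, `k > 0`, yields
the leg at every slowness `s' ≥ s` and every constant `k' ≥ k` (the `s`-triangle lies in the `s'`-triangle since
`t − t_y ≥ 0`; `1/(k'‖Λ‖²) ≤ 1/(k‖Λ‖²)`; `s (r_y − R₀) ≤ s' (r_y − R₀)`). [cite: arXiv08110354, §5.1] -/
theorem farIngoingLegAt_mono {s s' k k' : ℝ} (hs : 0 < s) (hss' : s ≤ s') (hk : 0 < k) (hkk' : k ≤ k')
    {𝒟 : VacuumCauchyDevelopment D} (h : FarIngoingLegAt s k 𝒟) : FarIngoingLegAt s' k' 𝒟 := by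
  intro Λ c M a hM ha R₀ hR₀ Ψ hΨ y hy hclose horient
  have hΛ := BoostedKerrLegs.one_le_norm_lorentz Λ
  have hK : 1 / (k' * ‖((Λ : E4 ≃L[ℝ] E4) : E4 →L[ℝ] E4)‖ ^ 2) ≤ 1 / (k * ‖((Λ : E4 ≃L[ℝ] E4) : E4 →L[ℝ] E4)‖ ^ 2) :=
    one_div_le_one_div_of_le (by positivity) (mul_le_mul_of_nonneg_right hkk' (by positivity))
  obtain ⟨x, hr, ht, ht', hJ⟩ := h Λ c M a hM ha R₀ hR₀ Ψ hΨ y hy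
    (fun x htx hRx hcone ↦ (hclose x htx hRx (by
      have h1 : ((boostedKerrBackground Λ c M a).time x.1 - (boostedKerrBackground Λ c M a).time y.1) / s'
          ≤ ((boostedKerrBackground Λ c M a).time x.1 - (boostedKerrBackground Λ c M a).time y.1) / s :=
        div_le_div_of_nonneg_left (sub_nonneg.2 htx) hs hss'
      linarith)).trans hK)
    horient
  exact ⟨x, hr, ht, ht'.trans (by linarith [mul_le_mul_of_nonneg_right hss' (sub_nonneg.2 hy)]), hJ⟩

/-- FIL_{s,k} for every slowness `s ≥ 3` and constant `k ≥ 20`, from `farIngoingLeg_holds` and monotonicity. [cite: arXiv08110354, §5.1] -/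
theorem farIngoingLegAt_of_three_le {s k : ℝ} (hs : 3 ≤ s) (hk : 20 ≤ k) (𝒟 : VacuumCauchyDevelopment D) :
    FarIngoingLegAt s k 𝒟 :=
  farIngoingLegAt_mono (by norm_num) hs (by norm_num) hk ((farIngoingLeg_iff_legAt 𝒟).1 (farIngoingLeg_holds 𝒟))

/-- `(t, y)¹ = y⁰`. [folklore] -/
private theorem ofTimeSpace_apply_one (t : ℝ) (y : E3) : E4.ofTimeSpace t y 1 = y 0 := E4.ofTimeSpace_apply_succ t y 0

/-- `(t, y)² = y¹`. [folklore] -/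
private theorem ofTimeSpace_apply_two (t : ℝ) (y : E3) : E4.ofTimeSpace t y 2 = y 1 := E4.ofTimeSpace_apply_succ t y 1

/-- `(t, y)³ = y²`. [folklore] -/
private theorem ofTimeSpace_apply_three (t : ℝ) (y : E3) : E4.ofTimeSpace t y 3 = y 2 := E4.ofTimeSpace_apply_succ t y 2

/-- **Kerr–Schild cone bound at large radius, every sub-light rest speed** (the `σ`-generic form of
`kerrBilin_ofTimeSpace_one_le`): at a point with `r > 0` and `H ≤ 1/100`, for rest-frame vectors `(1, η₁)`, `(1, η₂)`
with `‖ηⱼ‖ ≤ 1`: `g_{M,a}((1,η₁),(1,η₂)) = −1 + η₁·η₂ + 2H(1 + ℓ⃗·η₁)(1 + ℓ⃗·η₂) ≤ −1 + ‖η₁‖‖η₂‖ + (1 + ‖η₁‖)(1 + ‖η₂‖)/50`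
(`|ℓ⃗| = 1`, Cauchy–Schwarz; the ALIGNMENT-BLIND bound `|ℓ⃗·η| ≤ ‖η‖`).  Kerr–Schild form `g = η + 2H ℓ ⊗ ℓ`,
`H = Mr³/(r⁴ + a²z²)`: Visser arXiv:0706.0622, (32)–(35); reverse Cauchy–Schwarz for causal vectors: O'Neill 1983,
Ch. 5, Lemma 5.26. [cite: arXiv07060622, (32)–(35)] -/
theorem kerrBilin_ofTimeSpace_one_le_of_norm_le_one {M a : ℝ} (hM : 0 ≤ M) {x : E4} (hx : 0 < Kerr.radius a x)
    (hH : Kerr.scalarH M a x ≤ 1 / 100) (η₁ η₂ : E3) (h₁ : ‖η₁‖ ≤ 1) (h₂ : ‖η₂‖ ≤ 1) :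
    Kerr.bilin M a x (E4.ofTimeSpace 1 η₁) (E4.ofTimeSpace 1 η₂) ≤
      -1 + ‖η₁‖ * ‖η₂‖ + (1 + ‖η₁‖) * (1 + ‖η₂‖) / 50 := by
  -- adapted from `kerrBilin_ofTimeSpace_one_le` (Literature/Geometry/Lorentzian/BoostedKerrCausalLegs)
  have hH0 := Kerr.scalarH_nonneg hM a x
  have hl := Kerr.sum_sq_nullCovectorFun hx
  have h0 : Kerr.nullCovectorFun a x 0 = 1 := by simp [Kerr.nullCovectorFun]
  have hcov : ∀ η : E3, Kerr.nullCovector a x (E4.ofTimeSpace 1 η) = 1 + (Kerr.nullCovectorFun a x 1 * η 0 +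
      Kerr.nullCovectorFun a x 2 * η 1 + Kerr.nullCovectorFun a x 3 * η 2) := by
    intro η
    simp only [Kerr.nullCovector, E4.covector_apply, Fin.sum_univ_four, h0, E4.ofTimeSpace_apply_zero,
      ofTimeSpace_apply_one, ofTimeSpace_apply_two, ofTimeSpace_apply_three]
    ring
  have hmink : Minkowski.bilin (E4.ofTimeSpace 1 η₁) (E4.ofTimeSpace 1 η₂) =
      -1 + (η₁ 0 * η₂ 0 + η₁ 1 * η₂ 1 + η₁ 2 * η₂ 2) := by
    simp only [Minkowski.bilin_apply, Fin.sum_univ_three, E4.ofTimeSpace_apply_zero,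
      E4.ofTimeSpace_apply_succ]
    ring
  rw [Kerr.bilin_apply, hmink, hcov, hcov]
  generalize Kerr.nullCovectorFun a x 1 = l₁ at hl ⊢
  generalize Kerr.nullCovectorFun a x 2 = l₂ at hl ⊢
  generalize Kerr.nullCovectorFun a x 3 = l₃ at hl ⊢
  generalize Kerr.scalarH M a x = H at hH hH0 ⊢
  have hn1 := E3.norm_sq η₁
  have hn2 := E3.norm_sq η₂
  have hη₁ := norm_nonneg η₁
  have hη₂ := norm_nonneg η₂
  -- Cauchy–Schwarz, three times
  have hS : η₁ 0 * η₂ 0 + η₁ 1 * η₂ 1 + η₁ 2 * η₂ 2 ≤ ‖η₁‖ * ‖η₂‖ := by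
    have hsq : (η₁ 0 * η₂ 0 + η₁ 1 * η₂ 1 + η₁ 2 * η₂ 2) ^ 2 ≤ (‖η₁‖ * ‖η₂‖) ^ 2 := by
      rw [mul_pow, hn1, hn2]
      nlinarith [sq_nonneg (η₁ 0 * η₂ 1 - η₁ 1 * η₂ 0), sq_nonneg (η₁ 0 * η₂ 2 - η₁ 2 * η₂ 0),
        sq_nonneg (η₁ 1 * η₂ 2 - η₁ 2 * η₂ 1)]
    exact (abs_le_of_sq_le_sq' hsq (by positivity)).2
  have hm : ∀ η : E3, |l₁ * η 0 + l₂ * η 1 + l₃ * η 2| ≤ ‖η‖ := by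
    intro η
    have hn := E3.norm_sq η
    have hsq : (l₁ * η 0 + l₂ * η 1 + l₃ * η 2) ^ 2 ≤ ‖η‖ ^ 2 := by
      nlinarith [sq_nonneg (l₁ * η 1 - l₂ * η 0), sq_nonneg (l₁ * η 2 - l₃ * η 0),
        sq_nonneg (l₂ * η 2 - l₃ * η 1)]
    exact abs_le.2 (abs_le_of_sq_le_sq' hsq (norm_nonneg η))
  have hm₁ := abs_le.1 (hm η₁)
  have hm₂ := abs_le.1 (hm η₂)
  generalize l₁ * η₁ 0 + l₂ * η₁ 1 + l₃ * η₁ 2 = m₁ at hm₁ ⊢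
  generalize l₁ * η₂ 0 + l₂ * η₂ 1 + l₃ * η₂ 2 = m₂ at hm₂ ⊢
  have hA : 0 ≤ 1 + m₁ := by linarith [hm₁.1]
  have hB : 0 ≤ 1 + m₂ := by linarith [hm₂.1]
  have hP : (1 + m₁) * (1 + m₂) ≤ (1 + ‖η₁‖) * (1 + ‖η₂‖) :=
    mul_le_mul (by linarith [hm₁.2]) (by linarith [hm₂.2]) hB (by positivity)
  have hP0 : 0 ≤ (1 + m₁) * (1 + m₂) := mul_nonneg hA hB
  have hHP : 2 * H * ((1 + m₁) * (1 + m₂)) ≤ 2 * (1 / 100) * ((1 + ‖η₁‖) * (1 + ‖η₂‖)) :=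
    mul_le_mul (by linarith) hP hP0 (by norm_num)
  linarith

/-- **Chart cone bound, every sub-light rest speed and every closeness constant** (the `(σ, k)`-generic form of
`val_mfderiv_lorentz_le`): at a point of rest radius `≥ 100 M` where `‖Ψ^*g − g_B‖ ≤ 1/(k‖Λ‖²)`, `k > 0`, for
rest-frame directions `(1, η₁)`, `(1, η₂)` with `‖ηⱼ‖ ≤ 1`:
`g(dΨ Λ(1,η₁), dΨ Λ(1,η₂)) ≤ −1 + ‖η₁‖‖η₂‖ + (1 + ‖η₁‖)(1 + ‖η₂‖)/50 + (1 + ‖η₁‖)(1 + ‖η₂‖)/k`.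
Visser arXiv:0706.0622, (32)–(35); O'Neill 1983, Ch. 5, Lemma 5.26. [cite: arXiv07060622, (32)–(35)] -/
theorem val_mfderiv_lorentz_le_of_norm_le_one (𝒟 : VacuumCauchyDevelopment D) (Λ : lorentzGroup) (c : E4) {M : ℝ} (a : ℝ) (hM : 0 ≤ M)
    (Ψ : (boostedKerrBackground Λ c M a).domain → 𝒟.carrier) (x : (boostedKerrBackground Λ c M a).domain)
    (hr : 100 * M ≤ (boostedKerrBackground Λ c M a).radius x.1) {k : ℝ} (hk : 0 < k)
    (hdev : ‖𝒟.toSpacetime.deviation (boostedKerrBackground Λ c M a) Ψ x‖ ≤ 1 / (k * ‖((Λ : E4 ≃L[ℝ] E4) : E4 →L[ℝ] E4)‖ ^ 2))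
    (η₁ η₂ : E3) (h₁ : ‖η₁‖ ≤ 1) (h₂ : ‖η₂‖ ≤ 1) :
    𝒟.metric.val (Ψ x) (mfderiv 𝓘(ℝ, E4) (𝓡 4) Ψ x ((Λ : E4 ≃L[ℝ] E4) (E4.ofTimeSpace 1 η₁)))
        (mfderiv 𝓘(ℝ, E4) (𝓡 4) Ψ x ((Λ : E4 ≃L[ℝ] E4) (E4.ofTimeSpace 1 η₂))) ≤
      -1 + ‖η₁‖ * ‖η₂‖ + (1 + ‖η₁‖) * (1 + ‖η₂‖) / 50 + (1 + ‖η₁‖) * (1 + ‖η₂‖) / k := by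
  -- adapted from `val_mfderiv_lorentz_le` (Literature/Geometry/Lorentzian/BoostedKerrCausalLegs)
  set K := ‖((Λ : E4 ≃L[ℝ] E4) : E4 →L[ℝ] E4)‖ with hK
  have hK1 : 1 ≤ K := BoostedKerrLegs.one_le_norm_lorentz Λ
  have hKpos : 0 < K := one_pos.trans_le hK1
  have hx' : 0 < Kerr.radius a (poincareInv Λ c x.1) := Kerr.radius_pos_of_mem_region x.2
  have hH : Kerr.scalarH M a (poincareInv Λ c x.1) ≤ 1 / 100 := by
    have h1 := Kerr.scalarH_le_div hM a hx'
    have hr' : 100 * M ≤ Kerr.radius a (poincareInv Λ c x.1) := hr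
    calc Kerr.scalarH M a (poincareInv Λ c x.1) ≤ M / Kerr.radius a (poincareInv Λ c x.1) := h1
      _ ≤ 1 / 100 := by
          rw [div_le_div_iff₀ hx' (by norm_num : (0 : ℝ) < 100)]
          linarith
  have hmodel : (boostedKerrBackground Λ c M a).bilin x.1 ((Λ : E4 ≃L[ℝ] E4) (E4.ofTimeSpace 1 η₁))
      ((Λ : E4 ≃L[ℝ] E4) (E4.ofTimeSpace 1 η₂)) ≤ -1 + ‖η₁‖ * ‖η₂‖ + (1 + ‖η₁‖) * (1 + ‖η₂‖) / 50 := by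
    rw [boosted_bilin_apply₄₀]
    exact kerrBilin_ofTimeSpace_one_le_of_norm_le_one hM hx' hH η₁ η₂ h₁ h₂
  have hv : ∀ η : E3, ‖(Λ : E4 ≃L[ℝ] E4) (E4.ofTimeSpace 1 η)‖ ≤ K * (1 + ‖η‖) := fun η ↦
    (((Λ : E4 ≃L[ℝ] E4) : E4 →L[ℝ] E4).le_opNorm (E4.ofTimeSpace 1 η)).trans
      (mul_le_mul_of_nonneg_left (by simpa using BoostedKerrLegs.norm_ofTimeSpace_le 1 η) (norm_nonneg _))
  have h := val_mfderiv_le_of_norm_deviation_le₄₀ 𝒟 (boostedKerrBackground Λ c M a) Ψ x hdev _ _ hmodel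
  have hη₁ := norm_nonneg η₁
  have hη₂ := norm_nonneg η₂
  have hprod : ‖(Λ : E4 ≃L[ℝ] E4) (E4.ofTimeSpace 1 η₁)‖ * ‖(Λ : E4 ≃L[ℝ] E4) (E4.ofTimeSpace 1 η₂)‖ ≤
      (K * (1 + ‖η₁‖)) * (K * (1 + ‖η₂‖)) :=
    mul_le_mul (hv η₁) (hv η₂) (norm_nonneg _) (by positivity)
  have hδ : 0 ≤ 1 / (k * K ^ 2) := by positivity
  have hfin : 1 / (k * K ^ 2) * ‖(Λ : E4 ≃L[ℝ] E4) (E4.ofTimeSpace 1 η₁)‖ *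
      ‖(Λ : E4 ≃L[ℝ] E4) (E4.ofTimeSpace 1 η₂)‖ ≤ (1 + ‖η₁‖) * (1 + ‖η₂‖) / k := by
    calc 1 / (k * K ^ 2) * ‖(Λ : E4 ≃L[ℝ] E4) (E4.ofTimeSpace 1 η₁)‖ * ‖(Λ : E4 ≃L[ℝ] E4) (E4.ofTimeSpace 1 η₂)‖
        ≤ 1 / (k * K ^ 2) * ((K * (1 + ‖η₁‖)) * (K * (1 + ‖η₂‖))) := by
          rw [mul_assoc]; exact mul_le_mul_of_nonneg_left hprod hδ
      _ = (1 + ‖η₁‖) * (1 + ‖η₂‖) / k := by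
          field_simp
  linarith

/-- **Same-cone bound against the background time field, every sub-light rest speed** (the `(σ, k)`-generic form
of `val_mfderiv_timeVector_lt₄₀`): at a point of rest radius `≥ 100 M` where `‖Ψ^*g − g_B‖ ≤ 1/(k‖Λ‖²)` with `k ≥ 3`:
`g(dΨ ΛV, dΨ ΛV) < 0` and `g(dΨ ΛV, dΨ Λ(1, η)) < 0` for `‖η‖ ≤ 1` (`g_B(ΛV, ΛV) = −1 − 2H`, `g_B(ΛV, Λ(1,η)) = −1`,
`‖V‖ ≤ 11/10`, `‖(1, η)‖ ≤ 2`: the deviation terms are `≤ 121/(100 k)` and `≤ 11/(5k)`).  Visser arXiv:0706.0622,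
(32)–(35); Dafermos–Rodnianski arXiv:0811.0354, §5.1; O'Neill 1983, Ch. 5, Lemma 5.26. [cite: arXiv07060622, (32)–(35)] -/
theorem val_mfderiv_timeVector_lt_of_norm_le_one (𝒟 : VacuumCauchyDevelopment D) (Λ : lorentzGroup) (c : E4) {M : ℝ} (a : ℝ) (hM : 0 ≤ M)
    (Ψ : (boostedKerrBackground Λ c M a).domain → 𝒟.carrier) (x : (boostedKerrBackground Λ c M a).domain)
    (hr : 100 * M ≤ (boostedKerrBackground Λ c M a).radius x.1) {k : ℝ} (hk : 3 ≤ k)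
    (hdev : ‖𝒟.toSpacetime.deviation (boostedKerrBackground Λ c M a) Ψ x‖ ≤ 1 / (k * ‖((Λ : E4 ≃L[ℝ] E4) : E4 →L[ℝ] E4)‖ ^ 2))
    (η : E3) (hη : ‖η‖ ≤ 1) :
    𝒟.metric.val (Ψ x) (mfderiv 𝓘(ℝ, E4) (𝓡 4) Ψ x ((Λ : E4 ≃L[ℝ] E4) (Kerr.timeVector M a (poincareInv Λ c x.1))))
        (mfderiv 𝓘(ℝ, E4) (𝓡 4) Ψ x ((Λ : E4 ≃L[ℝ] E4) (Kerr.timeVector M a (poincareInv Λ c x.1)))) < 0 ∧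
      𝒟.metric.val (Ψ x) (mfderiv 𝓘(ℝ, E4) (𝓡 4) Ψ x ((Λ : E4 ≃L[ℝ] E4) (Kerr.timeVector M a (poincareInv Λ c x.1))))
        (mfderiv 𝓘(ℝ, E4) (𝓡 4) Ψ x ((Λ : E4 ≃L[ℝ] E4) (E4.ofTimeSpace 1 η))) < 0 := by
  -- adapted from `val_mfderiv_timeVector_lt₄₀` above with `1/20 ↦ 1/k`, `‖η‖ ≤ 1/2 ↦ ‖η‖ ≤ 1`
  set K := ‖((Λ : E4 ≃L[ℝ] E4) : E4 →L[ℝ] E4)‖ with hK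
  have hK1 : 1 ≤ K := BoostedKerrLegs.one_le_norm_lorentz Λ
  have hKpos : 0 < K := one_pos.trans_le hK1
  have hkpos : 0 < k := by linarith
  set z := poincareInv Λ c x.1 with hz
  have hz' : 0 < Kerr.radius a z := Kerr.radius_pos_of_mem_region x.2
  have hH : Kerr.scalarH M a z ≤ 1 / 100 := by
    have h1 := Kerr.scalarH_le_div hM a hz'
    have hr' : 100 * M ≤ Kerr.radius a z := hr
    calc Kerr.scalarH M a z ≤ M / Kerr.radius a z := h1
      _ ≤ 1 / 100 := by
          rw [div_le_div_iff₀ hz' (by norm_num : (0 : ℝ) < 100)]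
          linarith
  set V := Kerr.timeVector M a z with hV
  have hVn : ‖V‖ ≤ 11 / 10 := norm_timeVector_le₄₀ hM hz' hH
  have hΛV : ‖(Λ : E4 ≃L[ℝ] E4) V‖ ≤ K * (11 / 10) :=
    (((Λ : E4 ≃L[ℝ] E4) : E4 →L[ℝ] E4).le_opNorm V).trans (mul_le_mul_of_nonneg_left hVn (norm_nonneg _))
  have hΛη : ‖(Λ : E4 ≃L[ℝ] E4) (E4.ofTimeSpace 1 η)‖ ≤ K * 2 := by
    refine (((Λ : E4 ≃L[ℝ] E4) : E4 →L[ℝ] E4).le_opNorm _).trans (mul_le_mul_of_nonneg_left ?_ (norm_nonneg _))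
    have := BoostedKerrLegs.norm_ofTimeSpace_le 1 η
    rw [abs_one] at this
    linarith
  have hδ : 0 ≤ 1 / (k * K ^ 2) := by positivity
  have hkinv : 1 / k ≤ 1 / 3 := one_div_le_one_div_of_le (by norm_num) hk
  constructor
  · have hm : (boostedKerrBackground Λ c M a).bilin x.1 ((Λ : E4 ≃L[ℝ] E4) V) ((Λ : E4 ≃L[ℝ] E4) V) ≤ -1 := by
      rw [boosted_bilin_apply₄₀, ← hz, hV, Kerr.bilin_timeVector_timeVector hz']
      linarith [Kerr.scalarH_nonneg hM a z]
    have h := val_mfderiv_le_of_norm_deviation_le₄₀ 𝒟 _ Ψ x hdev _ _ hm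
    have hb : 1 / (k * K ^ 2) * ‖(Λ : E4 ≃L[ℝ] E4) V‖ * ‖(Λ : E4 ≃L[ℝ] E4) V‖ ≤ 121 / 100 * (1 / k) := by
      have h1 : ‖(Λ : E4 ≃L[ℝ] E4) V‖ * ‖(Λ : E4 ≃L[ℝ] E4) V‖ ≤ (K * (11 / 10)) * (K * (11 / 10)) :=
        mul_le_mul hΛV hΛV (norm_nonneg _) (by positivity)
      calc 1 / (k * K ^ 2) * ‖(Λ : E4 ≃L[ℝ] E4) V‖ * ‖(Λ : E4 ≃L[ℝ] E4) V‖
          ≤ 1 / (k * K ^ 2) * ((K * (11 / 10)) * (K * (11 / 10))) := by rw [mul_assoc]; exact mul_le_mul_of_nonneg_left h1 hδ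
        _ = 121 / 100 * (1 / k) := by field_simp; ring
    linarith
  · have hm : (boostedKerrBackground Λ c M a).bilin x.1 ((Λ : E4 ≃L[ℝ] E4) V) ((Λ : E4 ≃L[ℝ] E4) (E4.ofTimeSpace 1 η)) ≤ -1 := by
      rw [boosted_bilin_apply₄₀, ← hz, hV, Kerr.bilin_timeVector hz', E4.ofTimeSpace_apply_zero]
    have h := val_mfderiv_le_of_norm_deviation_le₄₀ 𝒟 _ Ψ x hdev _ _ hm
    have hb : 1 / (k * K ^ 2) * ‖(Λ : E4 ≃L[ℝ] E4) V‖ * ‖(Λ : E4 ≃L[ℝ] E4) (E4.ofTimeSpace 1 η)‖ ≤ 11 / 5 * (1 / k) := by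
      have h1 : ‖(Λ : E4 ≃L[ℝ] E4) V‖ * ‖(Λ : E4 ≃L[ℝ] E4) (E4.ofTimeSpace 1 η)‖ ≤ (K * (11 / 10)) * (K * 2) :=
        mul_le_mul hΛV hΛη (norm_nonneg _) (by positivity)
      calc 1 / (k * K ^ 2) * ‖(Λ : E4 ≃L[ℝ] E4) V‖ * ‖(Λ : E4 ≃L[ℝ] E4) (E4.ofTimeSpace 1 η)‖
          ≤ 1 / (k * K ^ 2) * ((K * (11 / 10)) * (K * 2)) := by rw [mul_assoc]; exact mul_le_mul_of_nonneg_left h1 hδ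
        _ = 11 / 5 * (1 / k) := by field_simp; ring
    linarith

/-- **Rest coordinates are round at large radius**: if `|a| ≤ M` and `100 M ≤ r(ξ)` then `‖ξ‖ ≤ (10001/10000)·r(ξ)`
(`‖ξ‖² ≤ r² + a² ≤ (1 + 10⁻⁴) r²`, from the `r`-quartic `r⁴ − (|x⃗|² − a²) r² − a² z² = 0`, Visser arXiv:0706.0622, (33)). [cite: arXiv07060622, (33)] -/
theorem norm_le_roundness_mul_radius {M a : ℝ} (haM : |a| ≤ M) (ξ : E3)
    (hr : 100 * M ≤ Kerr.radius a (E4.ofTimeSpace 0 ξ)) :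
    ‖ξ‖ ≤ 10001 / 10000 * Kerr.radius a (E4.ofTimeSpace 0 ξ) := by
  set r₀ := Kerr.radius a (E4.ofTimeSpace 0 ξ) with hr₀
  have h1 : ‖ξ‖ ^ 2 - a ^ 2 ≤ r₀ ^ 2 := by
    have h := Kerr.spatialNorm_sq_sub_sq_le_radius_sq a (E4.ofTimeSpace 0 ξ)
    rwa [E4.spatialNorm_ofTimeSpace] at h
  have h2 : a ^ 2 ≤ M ^ 2 := by
    have := abs_le.1 haM
    nlinarith
  have hM : 0 ≤ M := (abs_nonneg a).trans haM
  have hr₀' : 0 ≤ r₀ := Kerr.radius_nonneg a _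
  have h3 : ‖ξ‖ ^ 2 ≤ (10001 / 10000 * r₀) ^ 2 := by nlinarith
  exact (abs_le_of_sq_le_sq' h3 (by positivity)).2

/-- **The ALIGNED cone identity at `a = 0`**: in the ingoing Kerr–Schild (= ingoing Eddington–Finkelstein) chart of
Schwarzschild (`a = 0`: `r = ‖x⃗‖`, `ℓ = (1, x⃗/‖x⃗‖)`, `g = η + 2H ℓ ⊗ ℓ`), the straight INWARD radial direction
`v = (1, −σ x⃗/‖x⃗‖)` of rest speed `σ` at a point with `x⃗ ≠ 0` has `ℓ(v) = 1 − σ` and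
`g_{M,0}(v, v) = −1 + σ² + 2H(1 − σ)² = −(1 − σ)((1 + σ) − 2H(1 − σ))` — timelike for EVERY sub-light speed
`0 ≤ σ < 1` wherever `2H < (1 + σ)/(1 − σ)`, in particular wherever `2H < 1`: the ingoing chart's light cone is open
inward down to the horizon.  Nothing is claimed for `0 < |a| ≤ M` (the radial direction is then not `ℓ`-aligned).
Visser arXiv:0706.0622, (32)–(35) at `a = 0`; Dafermos–Rodnianski arXiv:0811.0354, §5.1. [cite: arXiv07060622, (32)–(35)] -/
theorem kerrBilin_radial_eq (M σ : ℝ) {x : E4} (hx : E4.spatial x ≠ 0) :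
    Kerr.bilin M 0 x (E4.ofTimeSpace 1 (-(σ / E4.spatialNorm x) • E4.spatial x))
        (E4.ofTimeSpace 1 (-(σ / E4.spatialNorm x) • E4.spatial x)) =
      -((1 - σ) * ((1 + σ) - 2 * Kerr.scalarH M 0 x * (1 - σ))) := by
  set ρ : ℝ := E4.spatialNorm x with hρ
  have hρpos : 0 < ρ := norm_pos_iff.2 hx
  have hρsq : ρ ^ 2 = x 1 ^ 2 + x 2 ^ 2 + x 3 ^ 2 := E4.spatialNorm_sq x
  have hρ2 : (x 1 ^ 2 + x 2 ^ 2 + x 3 ^ 2) / ρ ^ 2 = 1 := by rw [← hρsq, div_self (pow_ne_zero 2 hρpos.ne')]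
  have hr : Kerr.radius 0 x = ρ := Kerr.radius_zero_left x
  set η : E3 := -(σ / ρ) • E4.spatial x with hη
  have hη0 : η 0 = -(σ / ρ) * x 1 := by simp [hη, E4.spatial_apply]
  have hη1 : η 1 = -(σ / ρ) * x 2 := by simp [hη, E4.spatial_apply]
  have hη2 : η 2 = -(σ / ρ) * x 3 := by simp [hη, E4.spatial_apply]
  have h0 : Kerr.nullCovectorFun 0 x 0 = 1 := by simp [Kerr.nullCovectorFun]
  have h1 : Kerr.nullCovectorFun 0 x 1 = x 1 / ρ := by
    simp only [Kerr.nullCovectorFun, hr, Matrix.cons_val_one, Matrix.cons_val_zero, zero_mul, add_zero,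
      ne_eq, OfNat.ofNat_ne_zero, not_false_eq_true, zero_pow]
    field_simp
  have h2 : Kerr.nullCovectorFun 0 x 2 = x 2 / ρ := by
    simp only [Kerr.nullCovectorFun, hr, Matrix.cons_val, zero_mul, sub_zero, ne_eq, OfNat.ofNat_ne_zero,
      not_false_eq_true, zero_pow, add_zero]
    field_simp
  have h3 : Kerr.nullCovectorFun 0 x 3 = x 3 / ρ := by
    simp only [Kerr.nullCovectorFun, hr, Matrix.cons_val]
  have hcov : Kerr.nullCovector 0 x (E4.ofTimeSpace 1 η) = 1 - σ := by
    simp only [Kerr.nullCovector, E4.covector_apply, Fin.sum_univ_four, h0, h1, h2, h3, E4.ofTimeSpace_apply_zero,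
      ofTimeSpace_apply_one, ofTimeSpace_apply_two, ofTimeSpace_apply_three, hη0, hη1, hη2]
    calc 1 * 1 + x 1 / ρ * (-(σ / ρ) * x 1) + x 2 / ρ * (-(σ / ρ) * x 2) + x 3 / ρ * (-(σ / ρ) * x 3)
        = 1 - σ * ((x 1 ^ 2 + x 2 ^ 2 + x 3 ^ 2) / ρ ^ 2) := by ring
      _ = 1 - σ := by rw [hρ2, mul_one]
  have hmink : Minkowski.bilin (E4.ofTimeSpace 1 η) (E4.ofTimeSpace 1 η) = -1 + σ ^ 2 := by
    simp only [Minkowski.bilin_apply, Fin.sum_univ_three, E4.ofTimeSpace_apply_zero, E4.ofTimeSpace_apply_succ]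
    rw [hη0, hη1, hη2]
    calc -(1 * 1) + (-(σ / ρ) * x 1 * (-(σ / ρ) * x 1) + -(σ / ρ) * x 2 * (-(σ / ρ) * x 2) + -(σ / ρ) * x 3 * (-(σ / ρ) * x 3))
        = -1 + σ ^ 2 * ((x 1 ^ 2 + x 2 ^ 2 + x 3 ^ 2) / ρ ^ 2) := by ring
      _ = -1 + σ ^ 2 := by rw [hρ2, mul_one]
  rw [Kerr.bilin_apply, hmink, hcov]
  ring

set_option maxHeartbeats 400000 in -- typer-1 g1: 150k FAIL, 180k PASS at accept time; budget line (buildfix lane advice (b))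
/-- **The leg ladder is PAID below slowness `3`** (PDE-free): FIL_{s,k} for every slowness
`s > (51/49)·(10001/10000) ≈ 1.0409` and every closeness constant `k ≥ k₀(s) := 200 s / (49 s − 51·(10001/10000))` — a
closed-form grade map (`k₀(3) ≈ 6.25`, `k₀(2) ≈ 8.51`, `k₀(3/2) ≈ 13.3`, `k₀(11/10) ≈ 76`, `k₀(21/20) ≈ 472`; `k₀ ↑ ∞` as
`s ↓ (51/49)·1.0001`).  The proof of `farIngoingLeg_holds` (rest speed `½`, slope `1/3`, `k = 20`) made `σ`-generic: rest
coordinates `y = Λ(t₀, ξ) + c`, `r₀ = r(ξ) ≥ R₀ ≥ 100 M`, `r₀ ≤ ‖ξ‖ ≤ (10001/10000) r₀` (`norm_le_roundness_mul_radius`);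
rest speed `σ := (10001/10000)/s < 49/51`, direction `u = Λ(1, −σ ξ/‖ξ‖)`; the chart segment `θ ↦ y + θ u` has chart
time `t₀ + θ` and radius `≤ (1 − σθ/‖ξ‖) r₀ ≤ r₀ − θ/s` (`radius_smul_le`), so it stays in the `s`-triangle; stop it at
the FIRST parameter `θ⋆ ≤ (‖ξ‖/σ)(1 − R₀/r₀) ≤ s (r₀ − R₀)` with radius `R₀`.  Along it
`g(dΨu, dΨu) ≤ −1 + σ² + (1 + σ)²/50 + (1 + σ)²/k < 0` (`val_mfderiv_lorentz_le_of_norm_le_one`;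
`⟸ k(49 − 51σ) ≥ 200 > 50(1 + σ)`), so `dΨu` is timelike; at the shell end `dΨ(ΛV)` is future-directed (hypothesis)
with `g(dΨΛV, dΨu) < 0` (`val_mfderiv_timeVector_lt_of_norm_le_one`, `k ≥ 200/49 > 3`), hence `dΨu` is future-directed
there, hence along the connected segment (`isFutureDirected_mfderiv_apply_of_isPreconnected`), in particular at its
start; `leg_two_causal` concludes.  The sliver `1 < s ≤ (51/49)·1.0001` would need the ALIGNED sign of `ℓ(u)`
(`kerrBilin_radial_eq`, `a = 0`) and is not claimed; `s ≤ 1` is the light ceiling.  Dafermos–Rodnianski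
arXiv:0811.0354, §5.1 (far-zone cones); O'Neill 1983, Ch. 14, pp. 402–403. [cite: arXiv08110354, §5.1] -/
theorem farIngoingLegAt_of_lt_three {s k : ℝ} (hs : (51 : ℝ) / 49 * (10001 / 10000) < s)
    (hk : 200 * s / (49 * s - 51 * (10001 / 10000)) ≤ k) (𝒟 : VacuumCauchyDevelopment D) :
    FarIngoingLegAt s k 𝒟 := by
  -- Step 0: the constants — roundness `C = 10001/10000`, rest speed `σ = C/s < 49/51`, `k (49 − 51σ) ≥ 200`, `k ≥ 3`
  set C : ℝ := 10001 / 10000 with hC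
  have hCpos : 0 < C := by rw [hC]; norm_num
  have hspos : 0 < s := lt_trans (by norm_num) hs
  have hDpos : 0 < 49 * s - 51 * C := by rw [hC]; linarith
  have hkD : 200 * s ≤ k * (49 * s - 51 * C) := (div_le_iff₀ hDpos).1 hk
  set σ : ℝ := C / s with hσ
  have hσpos : 0 < σ := div_pos hCpos hspos
  have hσC : σ * s = C := div_mul_cancel₀ C hspos.ne'
  have hσlt : σ < 49 / 51 := by
    rw [hσ, div_lt_iff₀ hspos, hC]; linarith
  have hσle1 : σ ≤ 1 := by linarith
  have hkσ : 200 ≤ k * (49 - 51 * σ) := by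
    have h1 : k * (49 - 51 * σ) = k * (49 * s - 51 * C) / s := by
      rw [hσ]; field_simp
    rw [h1, le_div_iff₀ hspos]
    linarith
  have hkpos : 0 < k := by
    by_contra hcon
    push Not at hcon
    have : k * (49 - 51 * σ) ≤ 0 := mul_nonpos_of_nonpos_of_nonneg hcon (by linarith)
    linarith
  have hk3 : 3 ≤ k := by
    by_contra hcon
    push Not at hcon
    have : k * (49 - 51 * σ) < 3 * 49 := by nlinarith
    linarith
  have hcone : -1 + σ * σ + (1 + σ) * (1 + σ) / 50 + (1 + σ) * (1 + σ) / k < 0 := by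
    have h1 : (1 + σ) * (1 + σ) / k < 1 - σ * σ - (1 + σ) * (1 + σ) / 50 := by
      rw [div_lt_iff₀ hkpos]
      nlinarith [mul_le_mul_of_nonneg_left hkσ (by linarith : (0 : ℝ) ≤ 1 + σ), mul_pos (by linarith : (0 : ℝ) < 1 + σ) (by linarith : (0 : ℝ) < 3 - σ)]
    linarith
  intro Λ c M a hM haM R₀ hR₀ Ψ hΨ y hy hdev hfd
  -- Step 1: rest-frame coordinates `(t₀, ξ)` of `y`, rest radius `r₀`
  set z : E4 := poincareInv Λ c y.1 with hz
  set t₀ : ℝ := z 0 with ht₀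
  set ξ : E3 := E4.spatial z with hξ
  have hzts : E4.ofTimeSpace t₀ ξ = z := E4.ofTimeSpace_time_spatial z
  have hylab : y.1 = (Λ : E4 ≃L[ℝ] E4) (E4.ofTimeSpace t₀ ξ) + c := by
    rw [hzts, hz, BoostedKerrLegs.apply_poincareInv_add]
  have hty : (boostedKerrBackground Λ c M a).time y.1 = t₀ := rfl
  set r₀ : ℝ := Kerr.radius a (E4.ofTimeSpace 0 ξ) with hr₀
  have hry : (boostedKerrBackground Λ c M a).radius y.1 = r₀ := by
    show Kerr.radius a (poincareInv Λ c y.1) = r₀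
    rw [← hz, ← hzts, Kerr.radius_ofTimeSpace]
  have hR₀r₀ : R₀ ≤ r₀ := hry ▸ hy
  have hM100 : 100 * M ≤ r₀ := hR₀.trans hR₀r₀
  have hR₀pos : 0 < R₀ := by linarith
  have hr₀pos : 0 < r₀ := by linarith
  -- the trivial case `r_y = R₀`
  rcases hR₀r₀.eq_or_lt with heq | hlt
  · refine ⟨y, by rw [hry, heq], le_rfl, by rw [hry, heq, sub_self, mul_zero, add_zero], ?_⟩
    exact LorentzianMetric.mem_causalFuture_iff.2 (Or.inl rfl)
  -- Step 2: `r₀ ≤ ‖ξ‖ ≤ C r₀`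
  have hξr₀ : r₀ ≤ ‖ξ‖ := Kerr.radius_ofTimeSpace_le_norm a 0 ξ
  have hξpos : 0 < ‖ξ‖ := hr₀pos.trans_le hξr₀
  have hξup : ‖ξ‖ ≤ C * r₀ := norm_le_roundness_mul_radius haM ξ hM100
  -- Step 3: the inward direction `u = Λ(1, κ ξ)`, `κ = −σ/‖ξ‖` (rest speed `σ`), and the segment kinematics
  set κ : ℝ := -(σ / ‖ξ‖) with hκ
  have hκξ : ‖κ • ξ‖ = σ := by
    rw [norm_smul, Real.norm_eq_abs, hκ, abs_neg, abs_of_pos (by positivity)]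
    field_simp
  set u : E4 := (Λ : E4 ≃L[ℝ] E4) (E4.ofTimeSpace 1 (κ • ξ)) with hu
  have hrest : ∀ θ : ℝ, poincareInv Λ c (y.1 + θ • u) = E4.ofTimeSpace (t₀ + θ) ((1 + κ * θ) • ξ) := by
    intro θ
    have : y.1 + θ • u = (Λ : E4 ≃L[ℝ] E4) (E4.ofTimeSpace (t₀ + θ) ((1 + κ * θ) • ξ)) + c := by
      rw [hylab, hu, ofTimeSpace_affine₄₀, map_add, map_smul]; abel
    rw [this, poincareInv_apply_add₄₀]
  have htime : ∀ θ : ℝ, (boostedKerrBackground Λ c M a).time (y.1 + θ • u) = t₀ + θ := fun θ ↦ by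
    show poincareInv Λ c (y.1 + θ • u) 0 = _
    rw [hrest, E4.ofTimeSpace_apply_zero]
  have hradius : ∀ θ : ℝ, (boostedKerrBackground Λ c M a).radius (y.1 + θ • u) = Kerr.radius a (E4.ofTimeSpace 0 ((1 + κ * θ) • ξ)) := fun θ ↦ by
    show Kerr.radius a (poincareInv Λ c (y.1 + θ • u)) = _
    rw [hrest, Kerr.radius_ofTimeSpace]
  -- radius decay along the segment: `r(θ) ≤ r₀ − θ/s` for `0 ≤ θ ≤ θ₁ := (‖ξ‖/σ)(1 − R₀/r₀)`, and `r(θ₁) ≤ R₀`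
  set θ₁ : ℝ := ‖ξ‖ / σ * (1 - R₀ / r₀) with hθ₁
  have hθ₁nn : 0 ≤ θ₁ := by
    have : R₀ / r₀ ≤ 1 := (div_le_one hr₀pos).2 hR₀r₀
    have : 0 ≤ 1 - R₀ / r₀ := by linarith
    positivity
  have hθ₁le : θ₁ ≤ s * (r₀ - R₀) := by
    have h1 : θ₁ = ‖ξ‖ * (r₀ - R₀) / (σ * r₀) := by rw [hθ₁]; field_simp
    have h2 : s * (r₀ - R₀) = C * r₀ * (r₀ - R₀) / (σ * r₀) := by
      rw [← hσC]; field_simp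
    rw [h1, h2]
    exact div_le_div_of_nonneg_right (mul_le_mul_of_nonneg_right hξup (by linarith)) (by positivity)
  have hlam : ∀ θ ∈ Icc 0 θ₁, R₀ / r₀ ≤ 1 + κ * θ ∧ 1 + κ * θ ≤ 1 := by
    intro θ hθ
    have hκθ : κ * θ = -(σ * θ / ‖ξ‖) := by rw [hκ]; ring
    refine ⟨?_, by rw [hκθ]; linarith [div_nonneg (mul_nonneg hσpos.le hθ.1) hξpos.le]⟩
    have h1 : σ * θ / ‖ξ‖ ≤ σ * θ₁ / ‖ξ‖ :=
      div_le_div_of_nonneg_right (mul_le_mul_of_nonneg_left hθ.2 hσpos.le) hξpos.le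
    have h2 : σ * θ₁ / ‖ξ‖ = 1 - R₀ / r₀ := by rw [hθ₁]; field_simp
    rw [hκθ]; linarith
  have hdecay : ∀ θ ∈ Icc 0 θ₁, (boostedKerrBackground Λ c M a).radius (y.1 + θ • u) ≤ r₀ - θ / s := by
    intro θ hθ
    obtain ⟨hl, hu1⟩ := hlam θ hθ
    have hl0 : 0 < 1 + κ * θ := (div_pos hR₀pos hr₀pos).trans_le hl
    rw [hradius]
    refine (BoostedKerrLegs.radius_smul_le a ξ hl0 hu1 hr₀pos).trans ?_
    have hκθ : κ * θ = -(σ * θ / ‖ξ‖) := by rw [hκ]; ring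
    have h3 : θ / s ≤ σ * θ / ‖ξ‖ * r₀ := by
      rw [div_mul_eq_mul_div, div_le_div_iff₀ hspos hξpos]
      have h4 : θ * ‖ξ‖ ≤ θ * (C * r₀) := mul_le_mul_of_nonneg_left hξup hθ.1
      have h5 : θ * (C * r₀) = σ * θ * r₀ * s := by rw [← hσC]; ring
      linarith
    have h6 : (1 + -(σ * θ / ‖ξ‖)) * r₀ = r₀ - σ * θ / ‖ξ‖ * r₀ := by ring
    rw [hκθ, h6]; linarith
  have hθ₁rad : (boostedKerrBackground Λ c M a).radius (y.1 + θ₁ • u) ≤ R₀ := by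
    obtain ⟨hl, hu1⟩ := hlam θ₁ ⟨hθ₁nn, le_rfl⟩
    have hl0 : 0 < 1 + κ * θ₁ := (div_pos hR₀pos hr₀pos).trans_le hl
    rw [hradius]
    refine (BoostedKerrLegs.radius_smul_le a ξ hl0 hu1 hr₀pos).trans ?_
    have : 1 + κ * θ₁ = R₀ / r₀ := by rw [hκ, hθ₁]; field_simp; ring
    rw [this, div_mul_cancel₀ R₀ hr₀pos.ne']
  -- Step 4: the FIRST parameter `θ⋆` at which the segment reaches the shell `r = R₀`
  set F : ℝ → ℝ := fun θ ↦ (boostedKerrBackground Λ c M a).radius (y.1 + θ • u) with hF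
  have hFc : Continuous F :=
    (Kerr.continuous_radius a).comp ((continuous_poincareInv Λ c).comp (by fun_prop))
  set T : Set ℝ := Icc 0 θ₁ ∩ {θ | F θ ≤ R₀} with hT
  have hTc : IsClosed T := isClosed_Icc.inter (isClosed_le hFc continuous_const)
  have hTne : T.Nonempty := ⟨θ₁, ⟨hθ₁nn, le_rfl⟩, hθ₁rad⟩
  have hTbdd : BddBelow T := ⟨0, fun θ hθ ↦ hθ.1.1⟩
  set θs : ℝ := sInf T with hθs
  have hθsT : θs ∈ T := hTc.csInf_mem hTne hTbdd
  have hθs0 : 0 ≤ θs := hθsT.1.1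
  have hθs1 : θs ≤ θ₁ := hθsT.1.2
  have hFθs_le : F θs ≤ R₀ := hθsT.2
  have hF0 : F 0 = r₀ := by simp [hF, hry]
  have hbelow : ∀ θ, 0 ≤ θ → θ < θs → R₀ < F θ := by
    intro θ h0 hlt'
    by_contra hle
    push Not at hle
    have : θs ≤ θ := csInf_le hTbdd ⟨⟨h0, hlt'.le.trans hθs1⟩, hle⟩
    linarith
  have hθspos : 0 < θs := by
    rcases hθs0.eq_or_lt with h | h
    · exfalso; rw [← h, hF0] at hFθs_le; linarith
    · exact h
  have hFθs : F θs = R₀ := by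
    refine le_antisymm hFθs_le ?_
    by_contra hcon
    push Not at hcon
    obtain ⟨δ, hδ, hball⟩ := Metric.eventually_nhds_iff.1 (hFc.tendsto θs |>.eventually (gt_mem_nhds hcon))
    set θ' : ℝ := max 0 (θs - δ / 2) with hθ'
    have hθ'lt : θ' < θs := max_lt hθspos (by linarith)
    have hθ'0 : 0 ≤ θ' := le_max_left _ _
    have hdist : dist θ' θs < δ := by
      rw [Real.dist_eq, abs_sub_comm, abs_of_pos (by linarith)]
      have : θs - δ / 2 ≤ θ' := le_max_right _ _
      linarith
    have h1 : F θ' < R₀ := hball hdist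
    linarith [hbelow θ' hθ'0 hθ'lt]
  have hseg : ∀ θ ∈ Icc 0 θs, R₀ ≤ F θ ∧ F θ ≤ r₀ - θ / s := by
    intro θ hθ
    refine ⟨?_, hdecay θ ⟨hθ.1, hθ.2.trans hθs1⟩⟩
    rcases hθ.2.eq_or_lt with h | h
    · rw [h, hFθs]
    · exact (hbelow θ hθ.1 h).le
  -- Step 5: the segment lies in the domain, inside the `s`-triangle; `C⁰` control and causality along it
  have hmem : ∀ θ ∈ Icc 0 θs, y.1 + θ • u ∈ ((boostedKerrBackground Λ c M a).domain : Set E4) := by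
    intro θ hθ
    have hR : R₀ ≤ Kerr.radius a (poincareInv Λ c (y.1 + θ • u)) := (hseg θ hθ).1
    show poincareInv Λ c (y.1 + θ • u) ∈ Kerr.exterior M a
    rw [Kerr.mem_exterior]
    refine max_lt ?_ ?_
    · have : Kerr.rPlus M a ≤ 2 * M := rPlus_le_two_mul₄₀ hM.le a
      linarith
    · linarith
  have hdevseg : ∀ θ ∈ Icc 0 θs, ∀ h : y.1 + θ • u ∈ ((boostedKerrBackground Λ c M a).domain : Set E4),
      ‖𝒟.toSpacetime.deviation (boostedKerrBackground Λ c M a) Ψ ⟨y.1 + θ • u, h⟩‖ ≤ 1 / (k * ‖((Λ : E4 ≃L[ℝ] E4) : E4 →L[ℝ] E4)‖ ^ 2) := by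
    intro θ hθ h
    obtain ⟨hlo, hhi⟩ := hseg θ hθ
    refine hdev ⟨y.1 + θ • u, h⟩ ?_ hlo ?_
    · show (boostedKerrBackground Λ c M a).time y.1 ≤ (boostedKerrBackground Λ c M a).time (y.1 + θ • u)
      rw [htime, hty]; linarith [hθ.1]
    · show (boostedKerrBackground Λ c M a).radius (y.1 + θ • u) + ((boostedKerrBackground Λ c M a).time (y.1 + θ • u) - (boostedKerrBackground Λ c M a).time y.1) / s ≤ (boostedKerrBackground Λ c M a).radius y.1
      rw [htime, hty, hry]
      have h1 : (boostedKerrBackground Λ c M a).radius (y.1 + θ • u) = F θ := rfl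
      have h2 : (t₀ + θ - t₀) / s = θ / s := by ring_nf
      rw [h1, h2]
      linarith
  have hrseg : ∀ θ ∈ Icc 0 θs, 100 * M ≤ (boostedKerrBackground Λ c M a).radius (y.1 + θ • u) := fun θ hθ ↦ hR₀.trans (hseg θ hθ).1
  have hcauseg : ∀ θ ∈ Icc 0 θs, ∀ h : y.1 + θ • u ∈ ((boostedKerrBackground Λ c M a).domain : Set E4),
      𝒟.metric.IsCausal (mfderiv 𝓘(ℝ, E4) (𝓡 4) Ψ ⟨y.1 + θ • u, h⟩ u) := by
    intro θ hθ h
    have hv : 𝒟.metric.val (Ψ ⟨y.1 + θ • u, h⟩) (mfderiv 𝓘(ℝ, E4) (𝓡 4) Ψ ⟨y.1 + θ • u, h⟩ u)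
        (mfderiv 𝓘(ℝ, E4) (𝓡 4) Ψ ⟨y.1 + θ • u, h⟩ u) ≤ -1 + σ * σ + (1 + σ) * (1 + σ) / 50 + (1 + σ) * (1 + σ) / k := by
      have := val_mfderiv_lorentz_le_of_norm_le_one 𝒟 Λ c a hM.le Ψ ⟨y.1 + θ • u, h⟩ (hrseg θ hθ) hkpos
        (hdevseg θ hθ h) _ _ (hκξ.le.trans hσle1) (hκξ.le.trans hσle1)
      rwa [hκξ] at this
    exact (show 𝒟.metric.IsTimelike _ from lt_of_le_of_lt hv hcone).isCausal
  -- Step 6: the shell end point `e`; `dΨ(u)` is future-directed THERE (hypothesis on `dΨ(ΛV)` + same timecone)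
  have hemem : y.1 + θs • u ∈ ((boostedKerrBackground Λ c M a).domain : Set E4) := hmem θs ⟨hθs0, le_rfl⟩
  set e : (boostedKerrBackground Λ c M a).domain := ⟨y.1 + θs • u, hemem⟩ with he
  have hte : (boostedKerrBackground Λ c M a).time e.1 = t₀ + θs := htime θs
  have hre : (boostedKerrBackground Λ c M a).radius e.1 = R₀ := hFθs
  have hr₁ : 100 * M ≤ (boostedKerrBackground Λ c M a).radius e.1 := hrseg θs ⟨hθs0, le_rfl⟩
  have hdev₁ : ‖𝒟.toSpacetime.deviation (boostedKerrBackground Λ c M a) Ψ e‖ ≤ 1 / (k * ‖((Λ : E4 ≃L[ℝ] E4) : E4 →L[ℝ] E4)‖ ^ 2) :=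
    hdevseg θs ⟨hθs0, le_rfl⟩ hemem
  have hfd₀ : 𝒟.timeOrientation.IsFutureDirected
      (mfderiv 𝓘(ℝ, E4) (𝓡 4) Ψ e ((Λ : E4 ≃L[ℝ] E4) (Kerr.timeVector M a (poincareInv Λ c e.1)))) :=
    hfd e (by rw [hte, hty]; linarith) hre
  obtain ⟨htl₀, hcross⟩ := val_mfderiv_timeVector_lt_of_norm_le_one 𝒟 Λ c a hM.le Ψ e hr₁ hk3 hdev₁ (κ • ξ) (hκξ.le.trans hσle1)
  have hcau₀ : 𝒟.metric.IsCausal (mfderiv 𝓘(ℝ, E4) (𝓡 4) Ψ e u) := hcauseg θs ⟨hθs0, le_rfl⟩ hemem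
  have hfd_e : 𝒟.timeOrientation.IsFutureDirected (mfderiv 𝓘(ℝ, E4) (𝓡 4) Ψ e u) :=
    𝒟.timeOrientation.isFutureDirected_of_val_lt_zero hfd₀ htl₀ hcau₀ hcross
  -- Step 7: ONE SIGN along the connected segment — transport future-directedness from the end `e` back to the start `y`
  set ψ : E4 → 𝒟.carrier := Ψ ∘ (chartAt E4 y).symm with hψ
  have hψs : ContMDiffOn 𝓘(ℝ, E4) (𝓡 4) ((⊤ : ℕ∞) : WithTop ℕ∞) ψ ((boostedKerrBackground Λ c M a).domain : Set E4) :=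
    𝒟.toSpacetime.contMDiffOn_comp_chartAt_symm (boostedKerrBackground Λ c M a) Ψ y hΨ
  have hmd : ∀ {w : E4} (hw : w ∈ ((boostedKerrBackground Λ c M a).domain : Set E4)), MDifferentiableAt 𝓘(ℝ, E4) (𝓡 4) Ψ ⟨w, hw⟩ :=
    fun hw ↦ (hΨ ⟨_, hw⟩).mdifferentiableAt (by simp)
  set p : ℝ → E4 := fun θ ↦ y.1 + θ • u with hp
  have hpc : Continuous p := by fun_prop
  have hS : IsPreconnected (p '' Icc 0 θs) := isPreconnected_Icc.image p hpc.continuousOn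
  have hSO : p '' Icc 0 θs ⊆ ((boostedKerrBackground Λ c M a).domain : Set E4) := by
    rintro _ ⟨θ, hθ, rfl⟩
    exact hmem θ hθ
  have hcS : ∀ w ∈ p '' Icc 0 θs, 𝒟.metric.IsCausal (mfderiv 𝓘(ℝ, E4) (𝓡 4) ψ w u) := by
    rintro _ ⟨θ, hθ, rfl⟩
    exact (isCausal_comp_chartAt_symm_iff₄₀ 𝒟 (boostedKerrBackground Λ c M a) Ψ y (hmem θ hθ) (hmd (hmem θ hθ)) u).2 (hcauseg θ hθ (hmem θ hθ))
  have heS : y.1 + θs • u ∈ p '' Icc 0 θs := ⟨θs, ⟨hθs0, le_rfl⟩, rfl⟩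
  have h₁ : 𝒟.timeOrientation.IsFutureDirected (mfderiv 𝓘(ℝ, E4) (𝓡 4) ψ (y.1 + θs • u) u) :=
    (isFutureDirected_comp_chartAt_symm_iff₄₀ 𝒟 (boostedKerrBackground Λ c M a) Ψ y hemem (hmd hemem) u).2 hfd_e
  have hall := 𝒟.toSpacetime.isFutureDirected_mfderiv_apply_of_isPreconnected (boostedKerrBackground Λ c M a).domain.isOpen hψs hS hSO (fun _ ↦ u)
    continuousOn_const hcS heS h₁
  have hy0 : y.1 ∈ p '' Icc 0 θs := ⟨0, ⟨le_rfl, hθs0⟩, by simp [hp]⟩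
  have h0 : 𝒟.timeOrientation.IsFutureDirected (mfderiv 𝓘(ℝ, E4) (𝓡 4) Ψ ⟨y.1, y.2⟩ u) :=
    (isFutureDirected_comp_chartAt_symm_iff₄₀ 𝒟 (boostedKerrBackground Λ c M a) Ψ y y.2 (hmd y.2) u).1 (hall y.1 hy0)
  -- Step 8: leg 2 — the lifted segment is a future causal curve from `Ψ y` to `Ψ e`
  have hJ := BoostedKerrLegs.leg_two_causal 𝒟.toSpacetime (boostedKerrBackground Λ c M a) Ψ (boostedKerrBackground Λ c M a).domain.isOpen (fun _ h ↦ h) hΨ.contMDiffOn y.1 u hθspos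
    hmem hcauseg y.2 hemem h0
  refine ⟨e, hre, by rw [hte, hty]; linarith, ?_, hJ⟩
  rw [hte, hty, hry]
  linarith

/-- Round rungs of the grade map, each by `norm_num` from `farIngoingLegAt_of_lt_three`: FIL_{3,7} (improving
`FarIngoingLeg` = FIL_{3,20}). [cite: arXiv08110354, §5.1] -/
theorem farIngoingLegAt_three_seven (𝒟 : VacuumCauchyDevelopment D) : FarIngoingLegAt 3 7 𝒟 :=
  farIngoingLegAt_of_lt_three (by norm_num) (by norm_num) 𝒟

/-- FIL_{2,9}. [cite: arXiv08110354, §5.1] -/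
theorem farIngoingLegAt_two_nine (𝒟 : VacuumCauchyDevelopment D) : FarIngoingLegAt 2 9 𝒟 :=
  farIngoingLegAt_of_lt_three (by norm_num) (by norm_num) 𝒟

/-- FIL_{3/2,14}. [cite: arXiv08110354, §5.1] -/
theorem farIngoingLegAt_threeHalves (𝒟 : VacuumCauchyDevelopment D) : FarIngoingLegAt (3 / 2) 14 𝒟 :=
  farIngoingLegAt_of_lt_three (by norm_num) (by norm_num) 𝒟

/-- FIL_{11/10,76}. [cite: arXiv08110354, §5.1] -/
theorem farIngoingLegAt_elevenTenths (𝒟 : VacuumCauchyDevelopment D) : FarIngoingLegAt (11 / 10) 76 𝒟 :=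
  farIngoingLegAt_of_lt_three (by norm_num) (by norm_num) 𝒟

/-- FIL_{21/20,473}. [cite: arXiv08110354, §5.1] -/
theorem farIngoingLegAt_twentyoneTwentieths (𝒟 : VacuumCauchyDevelopment D) : FarIngoingLegAt (21 / 20) 473 𝒟 :=
  farIngoingLegAt_of_lt_three (by norm_num) (by norm_num) 𝒟

/-- **The paid leg ladder in the shape `s₀ ≤ s`, `k₀(s) ≤ k`** (non-strict threshold `s₀ = 21/20`; the grade map
`k₀(s) = 200 s/(49 s − 51·1.0001)` is DECREASING in `s`, so above `21/20` the single constant `473` also serves). [cite: arXiv08110354, §5.1] -/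
theorem farIngoingLegAt_of_le {s k : ℝ} (hs : (21 : ℝ) / 20 ≤ s) (hk : 200 * s / (49 * s - 51 * (10001 / 10000)) ≤ k)
    (𝒟 : VacuumCauchyDevelopment D) : FarIngoingLegAt s k 𝒟 :=
  farIngoingLegAt_of_lt_three (lt_of_lt_of_le (by norm_num) hs) hk 𝒟

end BoostedKerrLegs

end Literature.Geometry.Lorentzian
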